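import Literature.Probability.LatticeModels.IntersectionClusteringInduction
import Literature.Probability.LatticeModels.RegularScalesAbundance
import Literature.Probability.LatticeModels.BubbleDiagramGrowthDischarge
import Literature.Probability.LatticeModels.BackboneCurrent
import HarnessLib

/-!
# The improved tree diagram bound from the intersection and mixing properties (Aizenman–Duminil-Copin 2021, Thm 1.3 ⇐ Lemma 6.2 + Thm 6.4): the lattice assembly

Topic `Literature/Probability/LatticeModels`; family `crit-ising` (crit-ising.S13). Theorems and
auxiliary definitions only: **no named fact is introduced** (D-0026).

M. Aizenman, H. Duminil-Copin, *Marginal triviality of the scaling limits of critical 4D Ising and `φ⁴₄`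
models*, Ann. of Math. **194** (2021) = arXiv:1912.07973 [AizenmanDuminilCopinAnnals2021]. The tree's
named fact `aizenmanDuminilCopin_improvedTreeDiagramBound` (**Theorem 1.3**) is reduced by
`improvedTreeDiagramBound_of_boxClustering` (`ImprovedTreeDiagramBoundAssembly`) to the finite-volume
intersection-clustering bound (**Prop. 6.1**), and `Current.clusteringMassLT_le_of_inputs`
(`IntersectionClusteringInduction`) proves Prop. 6.1 on a finite graph from the printed probabilistic
inputs. This file supplies the remaining, lattice, part of §6.1 (p. 21–22):

* the geometry of the induced box graphs `boxGraph Λ`, `Λ ⊆ ℤ^d` (steps change the sup-distance by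
  at most one, distances are integers, boxes are connected so that `Z_Λ[{u,y}] > 0`);
* the finite-volume four-current quantities through which the inputs are stated on the lattice
  (`finVolFourMass`, `finVolFourNrm`, `finVolIkMass`, `latEdgesWithin`, `latEdgesBeyond`, junk value `0`
  when a point is outside `Λ`), and their dictionary with `IntersectionClusteringInduction`;
* the properties of the dynamic scales `ℓ_k = ℓ_k(β, D)` of §6.1 (`stateScale`, `dynScale` of
  `ImprovedTreeDiagramBoundAssembly`) that the printed proof invokes: "Using Lemma 6.3, we may choose
  `D = D(α)` such that `ℓ_{k+1} ≥ ℓ_k^α`" (`stateScale_pow_le_succ`, from the PROVED Lemma 6.3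
  `aizenmanDuminilCopin_bubbleDiagram_growth_holds`), `ℓ₁ → ∞` as `D → ∞`, and the growth of
  `log ℓ_k`;
* **the main theorem `improvedTreeDiagramBound_of_intersection_and_mixing`**: Theorem 1.3 follows from
  three lattice statements, each the finite-volume ("eventually in the box `Λ_L`, `L → ∞`") reading of
  a numbered result of the paper for the four-current measure `P^{ux,uz,∅,∅}` of the n.n. Ising model
  on `ℤ⁴`: `Hint` = **Lemma 6.2** (intersection property, for a far source `y` central in a regular scale),
  `Hmix` = **Theorem 6.4, (6.8)** (mixing, `t = 2`, `s = 4`, sources `{u,y},{u,y}`), and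
  `Hrel` = **Theorem 6.4, (6.9)** (insensitivity to the placement of the far sources). The proof is
  the printed one (p. 22): WLOG the far source of each pair, even usable indices `S ⊆ {2,4,…} ∩ [1,K-3]`,
  a regular `y ∈ Ann(ℓ_{K-1}, ℓ_K)` from Thm 5.12 (`exists_regularScale_between`), relocation of the
  sources, the induction of `IntersectionClusteringInduction`, the numerics
  `exists_delta_choose_mul_pow_le_exp_neg`, with `D` large.

What then remains of Theorem 1.3 (`_holds`) is exactly `Hint`, `Hmix`, `Hrel` — the finite-volume
Lemma 6.2 and Theorem 6.4 of the paper — whose ingredients the tree is accumulating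
(`IntersectionSecondMoment`, `RegularScales*`, `CrossingUniqueness*`, `BackboneChainRule*`,
`LocalizedSwitching`, `SplitEventOfNoCrossing`, `SourcelessConnectivity`, `DepletedPairConnection`, …).

## References

* M. Aizenman, H. Duminil-Copin, Ann. of Math. 194 (2021), arXiv:1912.07973: Thm 1.3 (p. 6), §6.1
  (definition of `ℓ_k`, Prop. 6.1, Lemma 6.2, Lemma 6.3, Thm 6.4 and the proof of Prop. 6.1, pp. 21–22),
  §4.2 (proof of Prop. 4.3, pp. 14–15), Thm 5.12 (p. 20) [AizenmanDuminilCopinAnnals2021].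

## Mathlib

`SimpleGraph.comap`/`Reachable`, `Subtype.dist_eq`, `Pi.single`, `Real.rpow`/`Real.log`/`Real.exp`,
`Filter.eventually_atTop`, `Finset.eventually_all`, `tendsto_rpow_neg_atTop`.
-/

noncomputable section

open MeasureTheory Finset Filter Topology
open scoped symmDiff ENNReal

namespace Literature.Probability.LatticeModels

/-! ### Part A. Geometry of the induced box graphs -/

section Geometry

variable {d : ℕ}

/-- Adjacency in `boxGraph Λ` is adjacency in `ℤ^d`. [folklore] -/
theorem boxGraph_adj_iff {Λ : Finset (Site d)} {a b : ↥Λ} :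
    (boxGraph Λ).Adj a b ↔ (zdGraph d).Adj (a : Site d) b := Iff.rfl

/-- The distance on `ℤ^d` (Pi sup norm) is the integer sup norm of the difference. [folklore] -/
theorem Site.dist_eq_supNorm (x y : Site d) : dist x y = (Site.supNorm (x - y) : ℝ) := by
  rw [dist_eq_norm, Site.norm_eq_supNorm]

/-- Nearest neighbours of `ℤ^d` are at sup-distance `1`. [folklore] -/
theorem dist_eq_one_of_zdGraph_adj {x y : Site d} (h : (zdGraph d).Adj x y) : dist x y = 1 := by
  rw [Site.dist_eq_supNorm]
  obtain ⟨i, hi | hi⟩ := (zdGraph_adj_iff x y).1 h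
  · rw [hi, sub_add_cancel_left, Site.supNorm_neg, Site.supNorm_single]; simp
  · rw [hi, add_sub_cancel_left, Site.supNorm_single]; simp

/-- **Steps change the distance to the centre by at most one** (the hypothesis `hstep` of
`AnnulusCrossing`/`IntersectionClusteringInduction`), for the induced graph on any `Λ ⊆ ℤ^d`. [folklore] -/
theorem boxGraph_dist_step {Λ : Finset (Site d)} (u v w : ↥Λ) (h : (boxGraph Λ).Adj v w) :
    dist u w ≤ dist u v + 1 := by
  have h1 : dist (v : Site d) w = 1 := dist_eq_one_of_zdGraph_adj (boxGraph_adj_iff.1 h)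
  calc dist u w ≤ dist u v + dist v w := dist_triangle _ _ _
    _ = dist u v + 1 := by rw [Subtype.dist_eq v w, h1]

/-- **Distances to the centre are integers** (the hypothesis `hdist`). [folklore] -/
theorem boxGraph_dist_natCast {Λ : Finset (Site d)} (u v : ↥Λ) : ∃ n : ℕ, dist u v = n :=
  ⟨Site.supNorm ((u : Site d) - (v : Site d)), by rw [Subtype.dist_eq, Site.dist_eq_supNorm]⟩

/-- Moving along one axis inside a box: `x` and `x + k eᵢ` are connected in `boxGraph (box d L)` when
both lie in the box (all intermediate points do). [folklore] -/
theorem boxGraph_reachable_add_single {L : ℕ} {x : Site d} (i : Fin d) (k : ℕ) (hx : x ∈ box d L)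
    (hxk : x + Pi.single i (k : ℤ) ∈ box d L) :
    (boxGraph (box d L)).Reachable ⟨x, hx⟩ ⟨x + Pi.single i (k : ℤ), hxk⟩ := by
  induction k with
  | zero =>
    have : x + Pi.single i ((0 : ℕ) : ℤ) = x := by simp
    exact ⟨(SimpleGraph.Walk.nil : (boxGraph (box d L)).Walk ⟨x, hx⟩ ⟨x, hx⟩).copy rfl (by simp)⟩
  | succ k ih =>
    -- the intermediate point `x + k eᵢ` lies in the box (its `i`-th coordinate is between those of
    -- `x` and `x + (k+1) eᵢ`)
    have hxk' : x + Pi.single i (k : ℤ) ∈ box d L := by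
      rw [mem_box] at hx hxk ⊢
      intro j
      by_cases hj : j = i
      · subst hj
        have h1 := hx j
        have h2 := hxk j
        simp only [Pi.add_apply, Pi.single_eq_same, Nat.cast_succ] at h1 h2 ⊢
        constructor <;> omega
      · have h1 := hx j
        simp only [Pi.add_apply, Pi.single_eq_of_ne hj, add_zero] at h1 ⊢
        exact h1
    have hadj : (boxGraph (box d L)).Adj ⟨x + Pi.single i (k : ℤ), hxk'⟩ ⟨x + Pi.single i ((k + 1 : ℕ) : ℤ), hxk⟩ := by
      rw [boxGraph_adj_iff, zdGraph_adj_iff]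
      refine ⟨i, Or.inl ?_⟩
      simp only [Nat.cast_succ, add_assoc, ← Pi.single_add]
    exact (ih hxk').trans hadj.reachable

/-- `Function.update x i t = x + (t - xᵢ) eᵢ`. [folklore] -/
theorem Site.update_eq_add_single (x : Site d) (i : Fin d) (t : ℤ) :
    Function.update x i t = x + Pi.single i (t - x i) := by
  funext j
  by_cases hj : j = i
  · subst hj; simp
  · simp [hj]

/-- Changing one coordinate inside a box: `x` and `update x i t` are connected in `boxGraph (box d L)`
for `x` in the box and `|t| ≤ L`. [folklore] -/
theorem boxGraph_reachable_update {L : ℕ} {x : Site d} (hx : x ∈ box d L) (i : Fin d) {t : ℤ}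
    (ht : -(L : ℤ) ≤ t ∧ t ≤ L) :
    ∃ h : Function.update x i t ∈ box d L, (boxGraph (box d L)).Reachable ⟨x, hx⟩ ⟨Function.update x i t, h⟩ := by
  have hmem : Function.update x i t ∈ box d L := by
    rw [mem_box] at hx ⊢
    intro j
    rw [Function.update_apply]
    split_ifs
    · exact ht
    · exact hx j
  refine ⟨hmem, ?_⟩
  rcases le_or_gt (x i) t with hle | hlt
  · -- move up by `k = t - xᵢ`
    obtain ⟨k, hk⟩ : ∃ k : ℕ, t - x i = k := ⟨(t - x i).toNat, (Int.toNat_of_nonneg (sub_nonneg.2 hle)).symm⟩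
    have heq : Function.update x i t = x + Pi.single i (k : ℤ) := by
      rw [Site.update_eq_add_single, hk]
    have hxk : x + Pi.single i (k : ℤ) ∈ box d L := heq ▸ hmem
    have h := boxGraph_reachable_add_single i k hx hxk
    have hv : (⟨x + Pi.single i (k : ℤ), hxk⟩ : ↥(box d L)) = ⟨Function.update x i t, hmem⟩ :=
      Subtype.ext heq.symm
    rwa [hv] at h
  · -- move down: `x = update x i t + k eᵢ` with `k = xᵢ - t`
    obtain ⟨k, hk⟩ : ∃ k : ℕ, x i - t = k := ⟨(x i - t).toNat, (Int.toNat_of_nonneg (sub_nonneg.2 hlt.le)).symm⟩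
    have heq : x = Function.update x i t + Pi.single i (k : ℤ) := by
      rw [Site.update_eq_add_single, ← hk, add_assoc, ← Pi.single_add]
      simp
    have hxk : Function.update x i t + Pi.single i (k : ℤ) ∈ box d L := heq ▸ hx
    have h := boxGraph_reachable_add_single i k hmem hxk
    have hv : (⟨Function.update x i t + Pi.single i (k : ℤ), hxk⟩ : ↥(box d L)) = ⟨x, hx⟩ :=
      Subtype.ext heq.symm
    rw [hv] at h
    exact h.symm

/-- **Boxes are connected**: any two sites of `box d L` are connected in `boxGraph (box d L)` (change
the coordinates one at a time; every intermediate site stays in the box). [folklore] -/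
theorem boxGraph_box_reachable {L : ℕ} {x y : Site d} (hx : x ∈ box d L) (hy : y ∈ box d L) :
    (boxGraph (box d L)).Reachable ⟨x, hx⟩ ⟨y, hy⟩ := by
  classical
  -- the partially modified sites `z s = (y on s, x off s)`
  set z : Finset (Fin d) → Site d := fun s j => if j ∈ s then y j else x j with hz
  have hzmem : ∀ s, z s ∈ box d L := by
    intro s
    rw [mem_box] at hx hy ⊢
    intro j
    simp only [hz]
    split_ifs
    · exact hy j
    · exact hx j
  have hz0 : z ∅ = x := by funext j; simp [hz]
  have hzu : z univ = y := by funext j; simp [hz]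
  have hins : ∀ s i, z (insert i s) = Function.update (z s) i (y i) := by
    intro s i
    funext j
    rw [Function.update_apply]
    by_cases hj : j = i
    · subst hj; simp [hz]
    · simp [hz, Finset.mem_insert, hj]
  have key : ∀ s : Finset (Fin d), (boxGraph (box d L)).Reachable ⟨x, hx⟩ ⟨z s, hzmem s⟩ := by
    intro s
    induction s using Finset.induction_on with
    | empty =>
      have hv : (⟨z ∅, hzmem ∅⟩ : ↥(box d L)) = ⟨x, hx⟩ := Subtype.ext hz0
      rw [hv]
    | insert i s hi ih =>
      have hyi : -(L : ℤ) ≤ y i ∧ y i ≤ L := (mem_box.1 hy) i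
      obtain ⟨hmem, hreach⟩ := boxGraph_reachable_update (hzmem s) i hyi
      have hv : (⟨Function.update (z s) i (y i), hmem⟩ : ↥(box d L)) = ⟨z (insert i s), hzmem _⟩ :=
        Subtype.ext (hins s i).symm
      rw [hv] at hreach
      exact ih.trans hreach
  have hv : (⟨z univ, hzmem univ⟩ : ↥(box d L)) = ⟨y, hy⟩ := Subtype.ext hzu
  rw [← hv]
  exact key univ

/-- **Positivity of the pair current sums in a box**: for `β > 0` and `u, y ∈ Λ_L`,
`Z_{Λ_L,β}[{u} ∆ {y}] > 0` (a simple path inside the box carries a current). [cite: DuminilCopin2016, §2.1] -/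
theorem ecurrentSum_pair_ne_zero_box {L : ℕ} {β : ℝ} (hβ : 0 < β) (u y : ↥(box d L)) :
    ecurrentSum (fun _ : (boxGraph (box d L)).edgeFinset => β) ({u} ∆ {y}) ≠ 0 := by
  have hK : ∀ e : (boxGraph (box d L)).edgeFinset, 0 ≤ (fun _ : (boxGraph (box d L)).edgeFinset => β) e :=
    fun _ => hβ.le
  have hreach : (boxGraph (box d L)).Reachable u y := by
    have h := boxGraph_box_reachable (d := d) (L := L) u.2 y.2
    exact h
  have hpos : 0 < currentSum (boxGraph (box d L)) β ({u} ∆ {y}) := Current.currentSum_pair_pos hβ hreach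
  intro h0
  have h1 : (ecurrentSum (fun _ : (boxGraph (box d L)).edgeFinset => β) ({u} ∆ {y})).toReal = 0 := by
    rw [h0, ENNReal.toReal_zero]
  rw [toReal_ecurrentSum hK, ← currentSum_eq_wcurrentSum] at h1
  exact hpos.ne' h1

end Geometry

/-! ### Part B. The finite-volume four-current quantities on `Λ ⊆ ℤ^d` and their dictionary -/

section FiniteVolume

variable {d : ℕ}

open Classical in
/-- The edges of `boxGraph Λ` **within `Λ_r(u)`** (all endpoints at sup-distance `≤ r` from `u ∈ ℤ^d`);
for `u ∈ Λ` this is `Current.edgesWithin ⟨u, _⟩ r`. [cite: AizenmanDuminilCopinAnnals2021, arXiv:1912.07973 Thm 6.4 ("edges within Λ_n")] -/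
def latEdgesWithin (Λ : Finset (Site d)) (u : Site d) (r : ℕ) : Finset (boxGraph Λ).edgeFinset :=
  univ.filter fun e => ∀ v ∈ (e : Sym2 ↥Λ), dist u (v : Site d) ≤ r

open Classical in
/-- The edges of `boxGraph Λ` **outside `Λ_r(u)`** (all endpoints at sup-distance `≥ r` from `u`);
for `u ∈ Λ` this is `Current.edgesBeyond ⟨u, _⟩ r`. [cite: AizenmanDuminilCopinAnnals2021, arXiv:1912.07973 Thm 6.4 ("edges … outside of Λ_N")] -/
def latEdgesBeyond (Λ : Finset (Site d)) (u : Site d) (r : ℕ) : Finset (boxGraph Λ).edgeFinset :=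
  univ.filter fun e => ∀ v ∈ (e : Sym2 ↥Λ), (r : ℝ) ≤ dist u (v : Site d)

/-- Dictionary: `latEdgesWithin Λ u r = Current.edgesWithin ⟨u, _⟩ r` for `u ∈ Λ`. [folklore] -/
theorem latEdgesWithin_eq {Λ : Finset (Site d)} {u : Site d} (hu : u ∈ Λ) (r : ℕ) :
    latEdgesWithin Λ u r = Current.edgesWithin (G := boxGraph Λ) ⟨u, hu⟩ r := by
  ext e
  unfold latEdgesWithin
  rw [Current.mem_edgesWithin, Finset.mem_filter]
  simp only [Finset.mem_univ, true_and]
  refine forall₂_congr fun v _ => ?_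
  rw [Subtype.dist_eq]

/-- Dictionary: `latEdgesBeyond Λ u r = Current.edgesBeyond ⟨u, _⟩ r` for `u ∈ Λ`. [folklore] -/
theorem latEdgesBeyond_eq {Λ : Finset (Site d)} {u : Site d} (hu : u ∈ Λ) (r : ℕ) :
    latEdgesBeyond Λ u r = Current.edgesBeyond (G := boxGraph Λ) ⟨u, hu⟩ r := by
  ext e
  unfold latEdgesBeyond
  rw [Current.mem_edgesBeyond, Finset.mem_filter]
  simp only [Finset.mem_univ, true_and]
  refine forall₂_congr fun v _ => ?_
  rw [Subtype.dist_eq]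

/-- **The un-normalised four-current expectation in a finite volume `Λ ⊆ ℤ^d`** (free boundary
condition, uniform coupling `β`, zero field): `E^{ua,ub,∅,∅}_Λ[Φ] · Z_Λ[∅]Z_Λ[{a,u}]Z_Λ[∅]Z_Λ[{b,u}]`,
i.e. `Current.fourMass` on the induced graph `boxGraph Λ`; junk value `0` if `u`, `a` or `b` is not in
`Λ`. [cite: AizenmanDuminilCopinAnnals2021, arXiv:1912.07973 §4.2 / §6.1, the measures P^{0x,0z,∅,∅}, P^{0y,0y,∅,∅} (finite-volume reading, "we work with finite Λ and then take the limit", App. A.2)] -/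
def finVolFourMass (Λ : Finset (Site d)) (β : ℝ) (u a b : Site d)
    (Φ : Current.FourCfg (boxGraph Λ) → ℝ≥0∞) : ℝ≥0∞ :=
  if h : u ∈ Λ ∧ a ∈ Λ ∧ b ∈ Λ then
    Current.fourMass (G := boxGraph Λ) (fun _ => β) ⟨u, h.1⟩ ⟨a, h.2.1⟩ ⟨b, h.2.2⟩ Φ
  else 0

/-- The normalisation `Z_Λ[∅]Z_Λ[{a,u}] · Z_Λ[∅]Z_Λ[{b,u}]` of `finVolFourMass` (junk `0` off `Λ`). [folklore] -/
def finVolFourNrm (Λ : Finset (Site d)) (β : ℝ) (u a b : Site d) : ℝ≥0∞ :=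
  if h : u ∈ Λ ∧ a ∈ Λ ∧ b ∈ Λ then
    Current.fourNrm (G := boxGraph Λ) (fun _ => β) ⟨u, h.1⟩ ⟨a, h.2.1⟩ ⟨b, h.2.2⟩
  else 0

open Classical in
/-- The annulus `u + Ann(a, b) = {v ∈ Λ : a ≤ ‖v - u‖_∞ ≤ b}` as a set of vertices of `boxGraph Λ`
(for `u ∈ Λ` and a scale sequence with `ℓ_k = a`, `ℓ_{k+1} = b` this is `annulusFinset ℓ ⟨u,_⟩ k`).
[cite: AizenmanDuminilCopinAnnals2021, arXiv:1912.07973 §4.1, Ann(k,n) and the annuli u + Ann(ℓ_k, ℓ_{k+1})] -/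
def latAnnulus (Λ : Finset (Site d)) (u : Site d) (a b : ℕ) : Finset ↥Λ :=
  univ.filter fun v => (a : ℝ) ≤ dist u (v : Site d) ∧ dist u (v : Site d) ≤ b

open Classical in
/-- **The un-normalised probability of the intersection event `I(a,b)`** of Aizenman–Duminil-Copin 2021
(unique crossing clusters of `u + Ann(a,b)` in `n₁+n₃` and in `n₂+n₄`, which intersect — the tree's
`Current.IkEvent`) under the finite-volume four currents `P^{uy,uy,∅,∅}_Λ`; junk `0` off `Λ`.
[cite: AizenmanDuminilCopinAnnals2021, arXiv:1912.07973 §6.1, Lemma 6.2 (the event I_k, p. 21)] -/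
def finVolIkMass (Λ : Finset (Site d)) (β : ℝ) (u y : Site d) (a b : ℕ) : ℝ≥0∞ :=
  if h : u ∈ Λ ∧ y ∈ Λ then
    Current.fourMass (G := boxGraph Λ) (fun _ => β) ⟨u, h.1⟩ ⟨y, h.2⟩ ⟨y, h.2⟩
      (fun pq => if Current.IkEvent (latAnnulus Λ u a b) a b ⟨u, h.1⟩ (pq.1.1 + pq.1.2) (pq.2.1 + pq.2.2)
        then 1 else 0)
  else 0

/-- Dictionary: the value of `finVolFourMass` for points of `Λ`. [folklore] -/
theorem finVolFourMass_eq {Λ : Finset (Site d)} (β : ℝ) {u a b : Site d} (hu : u ∈ Λ) (ha : a ∈ Λ)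
    (hb : b ∈ Λ) (Φ : Current.FourCfg (boxGraph Λ) → ℝ≥0∞) :
    finVolFourMass Λ β u a b Φ = Current.fourMass (G := boxGraph Λ) (fun _ => β) ⟨u, hu⟩ ⟨a, ha⟩ ⟨b, hb⟩ Φ := by
  unfold finVolFourMass
  rw [dif_pos ⟨hu, ha, hb⟩]

/-- Dictionary: the value of `finVolFourNrm` for points of `Λ`. [folklore] -/
theorem finVolFourNrm_eq {Λ : Finset (Site d)} (β : ℝ) {u a b : Site d} (hu : u ∈ Λ) (ha : a ∈ Λ)
    (hb : b ∈ Λ) :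
    finVolFourNrm Λ β u a b = Current.fourNrm (G := boxGraph Λ) (fun _ => β) ⟨u, hu⟩ ⟨a, ha⟩ ⟨b, hb⟩ := by
  unfold finVolFourNrm
  rw [dif_pos ⟨hu, ha, hb⟩]

/-- Dictionary: the annulus of a scale sequence around a vertex of `Λ` is `latAnnulus`. [folklore] -/
theorem annulusFinset_eq_latAnnulus {Λ : Finset (Site d)} {u : Site d} (hu : u ∈ Λ) (ℓ : ℕ → ℕ) (k : ℕ) :
    annulusFinset ℓ (⟨u, hu⟩ : ↥Λ) k = latAnnulus Λ u (ℓ k) (ℓ (k + 1)) := by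
  ext v
  unfold latAnnulus
  rw [mem_annulusFinset_iff, Finset.mem_filter, Subtype.dist_eq]
  simp

/-- Dictionary: `finVolIkMass Λ β u y (ℓ k) (ℓ (k+1))` is the `fourMass` of the tree's indicator
`Current.ikInd ℓ ⟨u,_⟩ k`. [folklore] -/
theorem finVolIkMass_eq {Λ : Finset (Site d)} (β : ℝ) {u y : Site d} (hu : u ∈ Λ) (hy : y ∈ Λ)
    (ℓ : ℕ → ℕ) (k : ℕ) :
    finVolIkMass Λ β u y (ℓ k) (ℓ (k + 1)) =
      Current.fourMass (G := boxGraph Λ) (fun _ => β) ⟨u, hu⟩ ⟨y, hy⟩ ⟨y, hy⟩ (Current.ikInd ℓ ⟨u, hu⟩ k) := by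
  unfold finVolIkMass
  rw [dif_pos ⟨hu, hy⟩]
  unfold Current.fourMass Current.ikInd
  refine tsum_congr fun pq => ?_
  rw [annulusFinset_eq_latAnnulus hu ℓ k]

/-- **From a bound on the clustering mass to a bound on the normalised ratio.** For `β ≥ 0`, points
`x₀,…,x₃, u ∈ Λ` and a finite constant `Cst`, if
`clusteringMassLT(θ)(x₀,x₁,x₂,x₃;u) ≤ Cst · Z[x₀u]Z[x₁u]Z[x₂u]Z[x₃u]` on `boxGraph Λ`, then
`finVolClusteringRatio Λ β ℓ K θ x₀ x₁ x₂ x₃ u ≤ Cst · ∏ⱼ ⟨σ_uσ_{xⱼ}⟩^∅_{Λ;β}` (division by `Z[∅]⁴`, the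
dictionary `isingTwoPoint_free_eq_currentSum_div_holds`, `isingTwoPoint_free_eq_boxGraph`). [folklore] -/
theorem finVolClusteringRatio_le_of_le {Λ : Finset (Site d)} {β : ℝ} (hβ : 0 ≤ β) (ℓ : ℕ → ℕ) (Ks θ : ℕ)
    {x : Fin 4 → Site d} {u : Site d} (hx : ∀ i, x i ∈ Λ) (hu : u ∈ Λ) {Cst : ℝ≥0∞} (hC : Cst ≠ ∞)
    (h : Current.clusteringMassLT (G := boxGraph Λ) (fun _ => β) ℓ Ks θ ⟨x 0, hx 0⟩ ⟨x 1, hx 1⟩ ⟨x 2, hx 2⟩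
        ⟨x 3, hx 3⟩ ⟨u, hu⟩ ≤
      Cst * (ecurrentSum (fun _ : (boxGraph Λ).edgeFinset => β) ({⟨x 0, hx 0⟩} ∆ {⟨u, hu⟩}) *
        ecurrentSum (fun _ : (boxGraph Λ).edgeFinset => β) ({⟨x 1, hx 1⟩} ∆ {⟨u, hu⟩}) *
        (ecurrentSum (fun _ : (boxGraph Λ).edgeFinset => β) ({⟨x 2, hx 2⟩} ∆ {⟨u, hu⟩}) *
          ecurrentSum (fun _ : (boxGraph Λ).edgeFinset => β) ({⟨x 3, hx 3⟩} ∆ {⟨u, hu⟩})))) :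
    finVolClusteringRatio Λ β ℓ Ks θ (x 0) (x 1) (x 2) (x 3) u ≤
      Cst.toReal * ∏ j, isingTwoPoint (zdGraph d) Λ β 0 .free u (x j) := by
  set G := boxGraph Λ with hG
  have hK : ∀ e : G.edgeFinset, 0 ≤ (fun _ : G.edgeFinset => β) e := fun _ => hβ
  set W : Finset ↥Λ → ℝ := fun A => wcurrentSum (fun _ : G.edgeFinset => β) A with hW
  have hW' : ∀ A, (ecurrentSum (fun _ : G.edgeFinset => β) A).toReal = W A := fun A => toReal_ecurrentSum hK A
  have hW0 : 0 < W ∅ := wcurrentSum_empty_pos hK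
  have hWnn : ∀ A, 0 ≤ W A := fun A => wcurrentSum_nonneg hK A
  have hZtop : ∀ A, ecurrentSum (fun _ : G.edgeFinset => β) A ≠ ∞ := fun A => ecurrentSum_ne_top hK A
  set xv : Fin 4 → ↥Λ := fun i => ⟨x i, hx i⟩ with hxv
  set uv : ↥Λ := ⟨u, hu⟩ with huv
  have h2pt : ∀ j, isingTwoPoint (zdGraph d) Λ β 0 .free u (x j) = W ({xv j} ∆ {uv}) / W ∅ := by
    intro j
    have h1 := isingTwoPoint_free_eq_boxGraph Λ β uv (xv j)
    simp only [huv, hxv] at h1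
    rw [h1, isingTwoPoint_free_eq_currentSum_div_holds, currentSum_eq_wcurrentSum, currentSum_eq_wcurrentSum,
      symmDiff_comm]
  have hxu : x 0 ∈ Λ ∧ x 1 ∈ Λ ∧ x 2 ∈ Λ ∧ x 3 ∈ Λ ∧ u ∈ Λ := ⟨hx 0, hx 1, hx 2, hx 3, hu⟩
  unfold finVolClusteringRatio
  rw [dif_pos hxu]
  have hR : Cst * (ecurrentSum (fun _ : G.edgeFinset => β) ({xv 0} ∆ {uv}) *
      ecurrentSum (fun _ : G.edgeFinset => β) ({xv 1} ∆ {uv}) *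
      (ecurrentSum (fun _ : G.edgeFinset => β) ({xv 2} ∆ {uv}) *
        ecurrentSum (fun _ : G.edgeFinset => β) ({xv 3} ∆ {uv}))) ≠ ∞ :=
    ENNReal.mul_ne_top hC (ENNReal.mul_ne_top (ENNReal.mul_ne_top (hZtop _) (hZtop _))
      (ENNReal.mul_ne_top (hZtop _) (hZtop _)))
  have hle := ENNReal.toReal_mono hR h
  simp only [ENNReal.toReal_mul, hW'] at hle
  rw [currentSum_eq_wcurrentSum, Fin.prod_univ_four, h2pt, h2pt, h2pt, h2pt]
  change _ / W ∅ ^ 4 ≤ Cst.toReal * (W _ / W ∅ * (W _ / W ∅) * (W _ / W ∅) * (W _ / W ∅))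
  rw [show Cst.toReal * (W ({xv 0} ∆ {uv}) / W ∅ * (W ({xv 1} ∆ {uv}) / W ∅) * (W ({xv 2} ∆ {uv}) / W ∅) *
      (W ({xv 3} ∆ {uv}) / W ∅)) =
    (Cst.toReal * (W ({xv 0} ∆ {uv}) * W ({xv 1} ∆ {uv}) * (W ({xv 2} ∆ {uv}) * W ({xv 3} ∆ {uv})))) / W ∅ ^ 4 by
      field_simp]
  exact div_le_div_of_nonneg_right hle (by positivity)

end FiniteVolume

/-! ### Part C. The dynamic scales `ℓ_k(β, D)`: power growth from Lemma 6.3, size of `ℓ₁`, growth of `log ℓ_k` -/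

section Scales

/-- `B_n ≤ |Λ_n| = (2n+1)⁴` for the bubble diagram of a probability measure on spin configurations
(`0 ≤ S ≤ 1`). [folklore] -/
theorem bubbleDiagram_nat_le_card (μ : Measure (SpinConfig (Site 4))) [IsProbabilityMeasure μ] (n : ℕ) :
    bubbleDiagram (twoPoint μ spinAt 0) (n : ℝ) ≤ (2 * (n : ℝ) + 1) ^ 4 := by
  have h0 : ∀ x, 0 ≤ twoPoint μ spinAt (0 : Site 4) x ^ 2 := fun x => sq_nonneg _
  have h1 : ∀ x, twoPoint μ spinAt (0 : Site 4) x ^ 2 ≤ 1 := by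
    intro x
    have habs : |twoPoint μ spinAt (0 : Site 4) x| ≤ 1 := by
      unfold twoPoint
      refine (abs_integral_le_integral_abs).trans ?_
      have : ∫ σ, |spinAt (0 : Site 4) σ * spinAt x σ| ∂μ ≤ ∫ _, (1 : ℝ) ∂μ := by
        refine integral_mono_of_nonneg (Eventually.of_forall fun σ => abs_nonneg _) (integrable_const 1)
          (Eventually.of_forall fun σ => ?_)
        show |spinAt (0 : Site 4) σ * spinAt x σ| ≤ 1
        rw [abs_mul, abs_spinAt, abs_spinAt, one_mul]
      simpa only [integral_const, probReal_univ, smul_eq_mul, mul_one] using this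
    exact (sq_le_one_iff_abs_le_one _).2 habs
  calc bubbleDiagram (twoPoint μ spinAt 0) (n : ℝ) = ∑ x ∈ box 4 n, twoPoint μ spinAt (0 : Site 4) x ^ 2 := by
        rw [bubbleDiagram_natCast]
    _ ≤ ∑ _x ∈ box 4 n, (1 : ℝ) := Finset.sum_le_sum fun x _ => h1 x
    _ = (2 * (n : ℝ) + 1) ^ 4 := by
        rw [Finset.sum_const, nsmul_eq_mul, mul_one, card_box]
        push_cast
        ring

/-- **`ℓ₁` is large when `D` is**: if the first infimum exists then `D ≤ B_{ℓ₁} ≤ (2ℓ₁+1)⁴`; hence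
`n₀ < ℓ₁` as soon as `(2n₀+1)⁴ < D`. [cite: AizenmanDuminilCopinAnnals2021, arXiv:1912.07973 §6.1, definition of ℓ_k (ℓ₁ = inf{ℓ : B_ℓ ≥ D})] -/
theorem lt_stateScale_one (μ : Measure (SpinConfig (Site 4))) [IsProbabilityMeasure μ] {D : ℝ} {n₀ : ℕ}
    (hD : (2 * (n₀ : ℝ) + 1) ^ 4 < D)
    (hinf : ∃ n : ℕ, D * bubbleDiagram (twoPoint μ spinAt 0) (stateScale μ D 0 : ℝ) ≤
      bubbleDiagram (twoPoint μ spinAt 0) (n : ℝ)) :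
    n₀ < stateScale μ D 1 := by
  have h1 := mul_le_apply_dynScale_succ (B := fun n : ℕ => bubbleDiagram (twoPoint μ spinAt 0) (n : ℝ))
    (D := D) (k := 0) hinf
  obtain ⟨-, -, hB0⟩ := bubbleDiagram_nat_basic μ
  simp only [dynScale_zero] at h1
  rw [hB0, mul_one] at h1
  have h2 := bubbleDiagram_nat_le_card μ (stateScale μ D 1)
  have h3 : (2 * (n₀ : ℝ) + 1) ^ 4 < (2 * (stateScale μ D 1 : ℝ) + 1) ^ 4 :=
    lt_of_lt_of_le hD (h1.trans h2)
  have h4 : (2 * (n₀ : ℝ) + 1) < 2 * (stateScale μ D 1 : ℝ) + 1 :=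
    lt_of_pow_lt_pow_left₀ 4 (by positivity) h3
  exact_mod_cast (by linarith : (n₀ : ℝ) < stateScale μ D 1)


/-- **The scales are non-decreasing** (`D > 1`): if the `k`-th infimum exists then
`B_{ℓ_{k+1}} ≥ D B_{ℓ_k} > B_{ℓ_k}`, so `ℓ_{k+1} > ℓ_k` by monotonicity of `B`; otherwise
`ℓ_{k+1} = 2ℓ_k + 1`. [cite: AizenmanDuminilCopinAnnals2021, arXiv:1912.07973 §6.1, definition of ℓ_k] -/
theorem stateScale_monotone (μ : Measure (SpinConfig (Site 4))) [IsProbabilityMeasure μ] {D : ℝ} (hD : 1 < D) :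
    Monotone (stateScale μ D) := by
  set B : ℕ → ℝ := fun n => bubbleDiagram (twoPoint μ spinAt 0) (n : ℝ) with hB
  obtain ⟨hBmono, hB1, -⟩ := bubbleDiagram_nat_basic μ
  have hℓ : stateScale μ D = dynScale B D := rfl
  rw [hℓ]
  refine monotone_nat_of_le_succ fun j => ?_
  by_contra hlt
  push Not at hlt
  by_cases hex : ∃ m : ℕ, D * B (dynScale B D j) ≤ B m
  · have h2 := mul_le_apply_dynScale_succ (B := B) (D := D) hex
    have h3 : B (dynScale B D (j + 1)) ≤ B (dynScale B D j) := hBmono hlt.le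
    have h4 : 0 < (D - 1) * B (dynScale B D j) := mul_pos (by linarith) (by linarith [hB1 (dynScale B D j)])
    nlinarith
  · rw [dynScale_succ_of_not_exists hex] at hlt
    omega

/-- **"Using Lemma 6.3, we may choose `D = D(α)` such that `ℓ_{k+1} ≥ ℓ_k^α`"** (Aizenman–Duminil-Copin
2021, proof of Prop. 6.1, p. 22). With `C` the constant of the PROVED growth lemma
`aizenmanDuminilCopin_bubbleDiagram_growth_holds` (Lemma 6.3): for `α ≥ 1` and
`D ≥ max(82, 1 + C(α+1))`, for `0 ≤ β ≤ β_c(4)`, `μ ∈ 𝒢(β,0)`, all `1 ≤ k < K` such that the first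
`K` infima exist and `ℓ_K` is in the window, `ℓ_k^α ≤ ℓ_{k+1}`. Proof: otherwise
`log(ℓ_{k+1}/ℓ_k) < (α-1) log ℓ_k`, so Lemma 6.3 gives `B_{ℓ_{k+1}} < (1 + C(α+1)) B_{ℓ_k} ≤ D B_{ℓ_k}`,
contradicting the definition of `ℓ_{k+1}`. [cite: AizenmanDuminilCopinAnnals2021, arXiv:1912.07973 §6.1, proof of Prop. 6.1 ("we may choose D = D(α) such that ℓ_{k+1} ≥ ℓ_k^α", p. 22) with Lemma 6.3 (p. 21)] -/
theorem stateScale_pow_le_succ :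
    ∃ Cg : ℝ, 0 < Cg ∧ ∀ (α D : ℝ), 1 ≤ α → 82 ≤ D → 1 + Cg * (α + 1) ≤ D →
      ∀ β : ℝ, 0 ≤ β → β ≤ criticalBeta 4 → ∀ μ ∈ isingGibbsMeasures 4 β 0, ∀ K k : ℕ, 1 ≤ k → k < K →
        (∀ j, j < K → ∃ n : ℕ, D * bubbleDiagram (twoPoint μ spinAt 0) (stateScale μ D j : ℝ) ≤
          bubbleDiagram (twoPoint μ spinAt 0) (n : ℝ)) →
        (β = criticalBeta 4 ∨ (0 < β ∧ (stateScale μ D K : ℝ) * invCorrLength (twoPointPlus 4 β) ≤ 1)) →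
        ((stateScale μ D k : ℕ) : ℝ) ^ α ≤ stateScale μ D (k + 1) := by
  obtain ⟨Cg, hCg, hgrowth⟩ := aizenmanDuminilCopin_bubbleDiagram_growth_holds
  obtain ⟨C', hC'0, hincr⟩ := exists_bubbleDiagram_increments
  refine ⟨Cg, hCg, fun α D hα hD82 hDα β hβ hβc μ hμ K k hk1 hkK hinf hwin => ?_⟩
  haveI : IsProbabilityMeasure μ := (isingGibbsMeasure_twoPoint_four hβ hβc hμ).1
  set B : ℕ → ℝ := fun n => bubbleDiagram (twoPoint μ spinAt 0) (n : ℝ) with hB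
  obtain ⟨hBmono, hB1, hB0⟩ := bubbleDiagram_nat_basic μ
  have hℓ : stateScale μ D = dynScale B D := rfl
  -- monotonicity of the scales: minimality `B_n < D B_{ℓ_j}` for `n < ℓ_{j+1}` and `D ≥ 1` give `ℓ_j ≤ ℓ_{j+1}`
  have hD1 : (1 : ℝ) ≤ D := by linarith
  have hmonoStep : ∀ j, dynScale B D j ≤ dynScale B D (j + 1) := by
    intro j
    by_contra hlt
    push Not at hlt
    by_cases hex : ∃ m : ℕ, D * B (dynScale B D j) ≤ B m
    · have h2 := mul_le_apply_dynScale_succ (B := B) (D := D) hex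
      have h3 : B (dynScale B D (j + 1)) ≤ B (dynScale B D j) := hBmono hlt.le
      have h4 : 0 < (D - 1) * B (dynScale B D j) := mul_pos (by linarith) (by linarith [hB1 (dynScale B D j)])
      nlinarith
    · rw [dynScale_succ_of_not_exists hex] at hlt
      omega
  have hmonoK : Monotone (dynScale B D) := monotone_nat_of_le_succ hmonoStep
  -- `ℓ₁ ≥ 2` since `B₁ ≤ 81 < D ≤ B_{ℓ₁}`
  have hK0 : 0 < K := by omega
  have hℓ1 : 2 ≤ dynScale B D 1 := by
    have h := lt_stateScale_one μ (n₀ := 1) (D := D) (by norm_num; linarith) (hinf 0 hK0)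
    rw [hℓ] at h
    omega
  set a : ℕ := dynScale B D k with ha
  set b : ℕ := dynScale B D (k + 1) with hb
  have hak : 2 ≤ a := hℓ1.trans (hmonoK hk1)
  have hab : a ≤ b := hmonoStep k
  have hbK : b ≤ dynScale B D K := hmonoK (Nat.succ_le_of_lt hkK)
  -- the window for `b`
  have hwinb : β = criticalBeta 4 ∨ (0 < β ∧ (b : ℝ) * invCorrLength (twoPointPlus 4 β) ≤ 1) := by
    rw [hℓ] at hwin
    exact adcWindow_mono hβ hwin (by exact_mod_cast hbK)
  -- `D B_a ≤ B_b`
  have hDab : D * B a ≤ B b := by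
    have := mul_le_apply_dynScale_succ (B := B) (D := D) (hinf k hkK)
    exact this
  by_contra hlt
  push Not at hlt
  -- `hlt : b < a^α`; logarithms
  have ha2 : (2 : ℝ) ≤ a := by exact_mod_cast hak
  have ha0 : (0 : ℝ) < a := by linarith
  have hb0 : (0 : ℝ) < b := by linarith [show (a : ℝ) ≤ b by exact_mod_cast hab]
  have hloga : Real.log 2 ≤ Real.log a := Real.log_le_log (by norm_num) ha2
  have hlog2 : (1 : ℝ) / 2 < Real.log 2 := by
    have := Real.log_two_gt_d9; linarith
  have hlogapos : 0 < Real.log a := by linarith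
  have hlogba : Real.log ((b : ℝ) / a) < (α - 1) * Real.log a := by
    rw [Real.log_div hb0.ne' ha0.ne']
    have : Real.log (b : ℝ) < α * Real.log a := by
      calc Real.log (b : ℝ) < Real.log ((a : ℝ) ^ α) := Real.log_lt_log hb0 hlt
        _ = α * Real.log a := Real.log_rpow ha0 α
    linarith
  have hlogba0 : 0 ≤ Real.log ((b : ℝ) / a) := Real.log_nonneg (by
    rw [le_div_iff₀ ha0, one_mul]; exact_mod_cast hab)
  -- Lemma 6.3
  have hG := hgrowth β a b hβ hβc hak hab hwinb μ hμ
  -- the factor is `< D`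
  have hfac : 1 + Cg * (1 + Real.log ((b : ℝ) / a)) / Real.log a < D := by
    have h1 : (1 + Real.log ((b : ℝ) / a)) / Real.log a < 2 + (α - 1) := by
      rw [div_lt_iff₀ hlogapos]
      have : 1 < 2 * Real.log a := by linarith
      nlinarith
    have h2 : Cg * ((1 + Real.log ((b : ℝ) / a)) / Real.log a) < Cg * (α + 1) := by
      have := mul_lt_mul_of_pos_left h1 hCg
      linarith
    rw [mul_div_assoc]
    linarith
  have hBa : 0 < B a := by linarith [hB1 a]
  have : B b < D * B a :=
    calc B b ≤ (1 + Cg * (1 + Real.log ((b : ℝ) / a)) / Real.log a) * B a := hG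
      _ < D * B a := mul_lt_mul_of_pos_right hfac hBa
  linarith

/-- Under the hypotheses of `stateScale_pow_le_succ`: **`log ℓ_{k+1} ≥ α log ℓ_k`**, and the scales
`ℓ_k`, `k ≥ 1`, are at least `2`. [cite: AizenmanDuminilCopinAnnals2021, arXiv:1912.07973 §6.1, proof of Prop. 6.1 (ℓ_{k+1} ≥ ℓ_k^α, p. 22)] -/
theorem stateScale_log_growth :
    ∃ Cg : ℝ, 0 < Cg ∧ ∀ (α D : ℝ), 1 ≤ α → 82 ≤ D → 1 + Cg * (α + 1) ≤ D →
      ∀ β : ℝ, 0 ≤ β → β ≤ criticalBeta 4 → ∀ μ ∈ isingGibbsMeasures 4 β 0, ∀ K : ℕ,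
        (∀ j, j < K → ∃ n : ℕ, D * bubbleDiagram (twoPoint μ spinAt 0) (stateScale μ D j : ℝ) ≤
          bubbleDiagram (twoPoint μ spinAt 0) (n : ℝ)) →
        (β = criticalBeta 4 ∨ (0 < β ∧ (stateScale μ D K : ℝ) * invCorrLength (twoPointPlus 4 β) ≤ 1)) →
        (∀ k, 1 ≤ k → k ≤ K → 2 ≤ stateScale μ D k) ∧
        (∀ k, 1 ≤ k → k < K → α * Real.log (stateScale μ D k) ≤ Real.log (stateScale μ D (k + 1))) ∧
        (∀ i, 1 + i ≤ K → α ^ i * Real.log (stateScale μ D 1) ≤ Real.log (stateScale μ D (1 + i))) := by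
  obtain ⟨Cg, hCg, hpow⟩ := stateScale_pow_le_succ
  refine ⟨Cg, hCg, fun α D hα hD82 hDα β hβ hβc μ hμ K hinf hwin => ?_⟩
  haveI : IsProbabilityMeasure μ := (isingGibbsMeasure_twoPoint_four hβ hβc hμ).1
  have hP := hpow α D hα hD82 hDα β hβ hβc μ hμ K
  -- `ℓ₁ ≥ 2` (when `K ≥ 1`) and the chain `ℓ_k ≥ ℓ_1`
  have htwo : ∀ k, 1 ≤ k → k ≤ K → 2 ≤ stateScale μ D k := by
    intro k hk1 hkK
    have hK0 : 0 < K := by omega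
    have h1 : 2 ≤ stateScale μ D 1 := by
      have h := lt_stateScale_one μ (n₀ := 1) (D := D) (by norm_num; linarith) (hinf 0 hK0)
      omega
    -- induction along the chain using the power growth (`ℓ_j ≤ ℓ_j^α ≤ ℓ_{j+1}` for `ℓ_j ≥ 1`)
    suffices key : ∀ i, 1 + i ≤ K → 2 ≤ stateScale μ D (1 + i) by
      have := key (k - 1) (by omega)
      rwa [show 1 + (k - 1) = k by omega] at this
    intro i
    induction i with
    | zero => intro _; simpa using h1
    | succ i ih =>
      intro hi
      have h2 := ih (by omega)
      have h3 := hP (1 + i) (by omega) (by omega) hinf hwin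
      have h4 : ((stateScale μ D (1 + i) : ℕ) : ℝ) ≤ ((stateScale μ D (1 + i) : ℕ) : ℝ) ^ α := by
        have h5 : (1 : ℝ) ≤ stateScale μ D (1 + i) := by exact_mod_cast (by omega : 1 ≤ stateScale μ D (1 + i))
        calc ((stateScale μ D (1 + i) : ℕ) : ℝ) = ((stateScale μ D (1 + i) : ℕ) : ℝ) ^ (1 : ℝ) := (Real.rpow_one _).symm
          _ ≤ ((stateScale μ D (1 + i) : ℕ) : ℝ) ^ α := Real.rpow_le_rpow_of_exponent_le h5 hα
      have h6 : ((stateScale μ D (1 + i) : ℕ) : ℝ) ≤ stateScale μ D (1 + i + 1) := h4.trans h3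
      rw [show 1 + (i + 1) = 1 + i + 1 by omega]
      exact_mod_cast (show (2 : ℝ) ≤ stateScale μ D (1 + i + 1) by
        calc (2 : ℝ) ≤ stateScale μ D (1 + i) := by exact_mod_cast h2
          _ ≤ _ := h6)
  have hlogstep : ∀ k, 1 ≤ k → k < K → α * Real.log (stateScale μ D k) ≤ Real.log (stateScale μ D (k + 1)) := by
    intro k hk1 hkK
    have h3 := hP k hk1 hkK hinf hwin
    have hk2 : (2 : ℝ) ≤ stateScale μ D k := by exact_mod_cast htwo k hk1 hkK.le
    have hk0 : (0 : ℝ) < stateScale μ D k := by linarith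
    calc α * Real.log (stateScale μ D k) = Real.log (((stateScale μ D k : ℕ) : ℝ) ^ α) :=
          (Real.log_rpow hk0 α).symm
      _ ≤ Real.log (stateScale μ D (k + 1)) := Real.log_le_log (Real.rpow_pos_of_pos hk0 α) h3
  refine ⟨htwo, hlogstep, ?_⟩
  intro i
  induction i with
  | zero => intro _; simp
  | succ i ih =>
    intro hi
    have h1 := ih (by omega)
    have h2 := hlogstep (1 + i) (by omega) (by omega)
    have hα0 : 0 ≤ α := by linarith
    calc α ^ (i + 1) * Real.log (stateScale μ D 1) = α * (α ^ i * Real.log (stateScale μ D 1)) := by ring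
      _ ≤ α * Real.log (stateScale μ D (1 + i)) := mul_le_mul_of_nonneg_left h1 hα0
      _ ≤ Real.log (stateScale μ D (1 + i + 1)) := h2
      _ = Real.log (stateScale μ D (1 + (i + 1))) := by rw [show 1 + (i + 1) = 1 + i + 1 by omega]

end Scales

/-! ### Part D. The usable indices, the numerics, and the assembly on the lattice -/

section Indices

/-- **The usable indices** `{2, 4, …, 2J}` (printed: "subsets `S` of even integers in `{1,…,K-3}`",
with `J = ⌊(K-3)/2⌋`). [cite: AizenmanDuminilCopinAnnals2021, arXiv:1912.07973 §6.1, proof of Prop. 6.1 ("we restrict ourselves to subsets S of even integers in {1,…,K−3}", p. 22)] -/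
def evenIndices (J : ℕ) : Finset ℕ := (range J).image fun j => 2 * j + 2

/-- Membership in `evenIndices`. [folklore] -/
theorem mem_evenIndices {J k : ℕ} : k ∈ evenIndices J ↔ ∃ j, j < J ∧ k = 2 * j + 2 := by
  unfold evenIndices
  simp only [Finset.mem_image, Finset.mem_range]
  constructor
  · rintro ⟨j, hj, rfl⟩; exact ⟨j, hj, rfl⟩
  · rintro ⟨j, hj, rfl⟩; exact ⟨j, hj, rfl⟩

/-- `|evenIndices J| = J`. [folklore] -/
theorem card_evenIndices (J : ℕ) : #(evenIndices J) = J := by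
  unfold evenIndices
  rw [Finset.card_image_of_injective _ (fun a b h => by simpa using h), Finset.card_range]

/-- The usable indices below `2i+2` are the first `i` of them. [folklore] -/
theorem evenIndices_filter_lt {J i : ℕ} (hi : i < J) :
    (evenIndices J).filter (· < 2 * i + 2) = evenIndices i := by
  ext k
  rw [Finset.mem_filter, mem_evenIndices, mem_evenIndices]
  constructor
  · rintro ⟨⟨j, hj, rfl⟩, hlt⟩
    exact ⟨j, by omega, rfl⟩
  · rintro ⟨j, hj, rfl⟩
    exact ⟨⟨j, by omega, rfl⟩, by omega⟩

/-- Gaps: two distinct usable indices differ by at least `2`. [folklore] -/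
theorem evenIndices_gap {J : ℕ} : ∀ k ∈ evenIndices J, ∀ k' ∈ evenIndices J, k < k' → k + 2 ≤ k' := by
  intro k hk k' hk' hlt
  obtain ⟨j, -, rfl⟩ := mem_evenIndices.1 hk
  obtain ⟨j', -, rfl⟩ := mem_evenIndices.1 hk'
  omega

/-- Range of the usable indices for `J = (K-3)/2`: `2 ≤ k ≤ K - 3`. [folklore] -/
theorem two_le_of_mem_evenIndices {K k : ℕ} (hk : k ∈ evenIndices ((K - 3) / 2)) : 2 ≤ k ∧ k + 3 ≤ K := by
  obtain ⟨j, hj, rfl⟩ := mem_evenIndices.1 hk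
  omega

end Indices

section RealLemmas

/-- If `C((α-1)T)^{-c} ≤ A` then `C x^{-c} ≤ A (α^{-c})^m` whenever `x ≥ (α-1) α^m T` (`α > 1`, `T > 0`,
`c ≥ 0`). [folklore] -/
theorem const_mul_rpow_neg_le {C c α T A x : ℝ} (hC : 0 ≤ C) (hc : 0 ≤ c) (hα : 1 < α) (hT : 0 < T)
    (hA : C * ((α - 1) * T) ^ (-c) ≤ A) (m : ℕ) (hx : (α - 1) * α ^ m * T ≤ x) :
    C * x ^ (-c) ≤ A * (α ^ (-c)) ^ m := by
  have hα0 : 0 < α := by linarith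
  have hα1 : 0 < α - 1 := by linarith
  set y : ℝ := (α - 1) * T * α ^ m with hy
  have hy0 : 0 < y := by positivity
  have hyx : y ≤ x := by rw [hy]; linarith [hx, show (α - 1) * T * α ^ m = (α - 1) * α ^ m * T by ring]
  have h1 : x ^ (-c) ≤ y ^ (-c) := Real.rpow_le_rpow_of_nonpos hy0 hyx (by linarith)
  have h2 : y ^ (-c) = ((α - 1) * T) ^ (-c) * (α ^ (-c)) ^ m := by
    rw [hy, Real.mul_rpow (by positivity) (by positivity)]
    congr 1
    rw [← Real.rpow_natCast α m, ← Real.rpow_mul hα0.le, mul_comm, Real.rpow_mul hα0.le, Real.rpow_natCast]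
  have hpm : 0 ≤ (α ^ (-c)) ^ m := pow_nonneg (Real.rpow_nonneg hα0.le _) m
  calc C * x ^ (-c) ≤ C * y ^ (-c) := mul_le_mul_of_nonneg_left h1 hC
    _ = C * ((α - 1) * T) ^ (-c) * (α ^ (-c)) ^ m := by rw [h2]; ring
    _ ≤ A * (α ^ (-c)) ^ m := mul_le_mul_of_nonneg_right hA hpm

/-- The threshold making `C t^{-c} ≤ A`: `t ≥ (C/A)^{1/c}` (`C, c, A > 0`). [folklore] -/
theorem const_mul_rpow_neg_le_of_ge {C c A t : ℝ} (hC : 0 < C) (hc : 0 < c) (hA : 0 < A)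
    (ht : (C / A) ^ (1 / c) ≤ t) : C * t ^ (-c) ≤ A := by
  set T₀ : ℝ := (C / A) ^ (1 / c) with hT₀
  have hT₀pos : 0 < T₀ := Real.rpow_pos_of_pos (div_pos hC hA) _
  have h1 : t ^ (-c) ≤ T₀ ^ (-c) := Real.rpow_le_rpow_of_nonpos hT₀pos ht (by linarith)
  have h2 : T₀ ^ (-c) = A / C := by
    rw [hT₀, ← Real.rpow_mul (div_pos hC hA).le, show (1 / c) * (-c) = -1 by field_simp,
      Real.rpow_neg_one, inv_div]
  calc C * t ^ (-c) ≤ C * (A / C) := by rw [← h2]; exact mul_le_mul_of_nonneg_left h1 hC.le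
    _ = A := by field_simp

/-- The threshold making `α^{-c} ≤ q`: `α ≥ q^{-1/c}` (`c, q > 0`). [folklore] -/
theorem rpow_neg_le_of_ge {α c q : ℝ} (hc : 0 < c) (hq : 0 < q) (hα : q ^ (-(1 / c)) ≤ α) : α ^ (-c) ≤ q := by
  have h0 : 0 < q ^ (-(1 / c)) := Real.rpow_pos_of_pos hq _
  calc α ^ (-c) ≤ (q ^ (-(1 / c))) ^ (-c) := Real.rpow_le_rpow_of_nonpos h0 hα (by linarith)
    _ = q := by
        rw [← Real.rpow_mul hq.le, show (-(1 / c)) * (-c) = 1 by field_simp, Real.rpow_one]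

/-- `2 e^{-t} ≤ 2^{-t/2}` for `t ≥ 4`. [folklore] -/
theorem two_mul_exp_neg_le_two_rpow {t : ℝ} (ht : 4 ≤ t) : 2 * Real.exp (-t) ≤ (2 : ℝ) ^ (-(t / 2)) := by
  have hlog2 : Real.log 2 < 7 / 10 := by linarith [Real.log_two_lt_d9]
  have hlog2' : 0 < Real.log 2 := Real.log_pos (by norm_num)
  rw [Real.rpow_def_of_pos (by norm_num : (0 : ℝ) < 2)]
  have h2 : (2 : ℝ) * Real.exp (-t) = Real.exp (Real.log 2 + -t) := by
    rw [Real.exp_add, Real.exp_log (by norm_num)]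
  rw [h2, Real.exp_le_exp]
  nlinarith

/-- **The numerics of the proof of Prop. 6.1** ("`≤ binom(K/2, δK)(1-c₀)^{(½-δ)K}`, which implies the
claim by appropriately choosing the value of `δ`", p. 15), including the relocation error: with `δ₁`
from `exists_delta_choose_mul_pow_le_exp_neg`, `J = ⌊(K-3)/2⌋` usable indices, `1 ≤ θ ≤ δ₁K/2 + 1`,
`δ₁K ≥ 4` and a relocation error `ε_r ≤ 2^{-K/2} e^{-δ₁K}`:
`binom(J, J+1-θ)((1-c₀)^{J+1-θ} + ε_r) ≤ 2 e^{-δ₁K} ≤ 2^{-δ₁K/2}`. [cite: AizenmanDuminilCopinAnnals2021, arXiv:1912.07973 §4.2, proof of Prop. 4.3 (last display, p. 15)] -/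
theorem choose_mul_add_le_two_rpow {c₀ δ₁ εr : ℝ} {K J θ : ℕ}
    (hNum : ∀ K n j : ℕ, 8 ≤ K → (K : ℝ) / 2 - 2 ≤ n → n ≤ K → (j : ℝ) ≤ δ₁ * K →
      (n.choose j : ℝ) * (1 - c₀) ^ (n - j) ≤ Real.exp (-(δ₁ * K)))
    (hK : 8 ≤ K) (hJ1 : (K : ℝ) / 2 - 2 ≤ J) (hJ2 : J ≤ K) (hJ3 : (J : ℝ) ≤ K / 2)
    (hθ1 : 1 ≤ θ) (hθJ : θ - 1 ≤ J) (hθδ : ((θ - 1 : ℕ) : ℝ) ≤ δ₁ * K) (hδK : 4 ≤ δ₁ * K)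
    (hεr0 : 0 ≤ εr) (hεr : (2 : ℝ) ^ ((K : ℝ) / 2) * εr ≤ Real.exp (-(δ₁ * K))) :
    (J.choose (J + 1 - θ) : ℝ) * ((1 - c₀) ^ (J + 1 - θ) + εr) ≤ (2 : ℝ) ^ (-(δ₁ * K / 2)) := by
  have hsymm : J.choose (J + 1 - θ) = J.choose (θ - 1) := by
    rw [show J + 1 - θ = J - (θ - 1) by omega]
    exact Nat.choose_symm hθJ
  have hexp : J + 1 - θ = J - (θ - 1) := by omega
  -- first term
  have h1 : (J.choose (J + 1 - θ) : ℝ) * (1 - c₀) ^ (J + 1 - θ) ≤ Real.exp (-(δ₁ * K)) := by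
    rw [hsymm, hexp]
    exact hNum K J (θ - 1) hK hJ1 hJ2 hθδ
  -- second term: `binom ≤ 2^J ≤ 2^{K/2}`
  have h2 : (J.choose (J + 1 - θ) : ℝ) * εr ≤ Real.exp (-(δ₁ * K)) := by
    have hch : (J.choose (J + 1 - θ) : ℝ) ≤ (2 : ℝ) ^ ((K : ℝ) / 2) :=
      calc (J.choose (J + 1 - θ) : ℝ) ≤ ((2 ^ J : ℕ) : ℝ) := by exact_mod_cast Nat.choose_le_two_pow J _
        _ = (2 : ℝ) ^ (J : ℝ) := by rw [Nat.cast_pow, Nat.cast_ofNat, Real.rpow_natCast]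
        _ ≤ (2 : ℝ) ^ ((K : ℝ) / 2) := Real.rpow_le_rpow_of_exponent_le (by norm_num) hJ3
    calc (J.choose (J + 1 - θ) : ℝ) * εr ≤ (2 : ℝ) ^ ((K : ℝ) / 2) * εr := mul_le_mul_of_nonneg_right hch hεr0
      _ ≤ Real.exp (-(δ₁ * K)) := hεr
  calc (J.choose (J + 1 - θ) : ℝ) * ((1 - c₀) ^ (J + 1 - θ) + εr)
      = (J.choose (J + 1 - θ) : ℝ) * (1 - c₀) ^ (J + 1 - θ) + (J.choose (J + 1 - θ) : ℝ) * εr := by ring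
    _ ≤ Real.exp (-(δ₁ * K)) + Real.exp (-(δ₁ * K)) := add_le_add h1 h2
    _ = 2 * Real.exp (-(δ₁ * K)) := by ring
    _ ≤ (2 : ℝ) ^ (-(δ₁ * K / 2)) := two_mul_exp_neg_le_two_rpow hδK

end RealLemmas

section Assembly

/-- **The finite-volume inputs feed the induction: Prop. 6.1 in the boxes `Λ_L`, modulo the three
lattice inputs at fixed scales.** For `β > 0`, a monotone scale sequence `ℓ`, usable indices `E`
(gaps `≥ 2`, annuli inside `Λ_R(u)`), far sources `x_f, z_f` (distance `≥ R` from `u`) and a far vertex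
`y`: if, eventually in `L`, the intersection property holds in `Λ_L` at every usable annulus (`hint`), the
mixing property holds in `Λ_L` at every usable pair of scales with errors `ε_s ≤ c₀(1-c₀)^{#{k∈E:k<s}}`
(`hmix`, `hε`), and the relocation inequality holds in `Λ_L` with error `ε_r` (`hrel`), then eventually in
`L`, for all second sources `y_o, t_o` and every threshold `θ`,
`clusteringMassLT_{Λ_L}(θ)(x_f,y_o,z_f,t_o;u) ≤ binom(|E|,|E|+1-θ)((1-c₀)^{|E|+1-θ} + ε_r) Z[y_ou]Z[x_fu]Z[t_ou]Z[z_fu]`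
(`Current.clusteringMassLT_le_of_inputs` on `boxGraph (box 4 L)`, with the dictionary of Part B, the
geometry of Part A and `Z_{Λ_L}[{u,y}] > 0`). [cite: AizenmanDuminilCopinAnnals2021, arXiv:1912.07973 §6.1, proof of Prop. 6.1 (p. 22); §4.2, proof of Prop. 4.3 (pp. 14–15)] -/
theorem clusteringMassLT_box_le_of_eventually {β : ℝ} (hβ : 0 < β) (ℓ : ℕ → ℕ) (hℓ : Monotone ℓ)
    {K : ℕ} {E : Finset ℕ} (hE : E ⊆ range (K + 1)) (hgap : ∀ k ∈ E, ∀ k' ∈ E, k < k' → k + 2 ≤ k')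
    {R : ℕ} (hR : ∀ k ∈ E, ℓ (k + 1) ≤ R)
    {u y xf zf : Site 4} (hxf : (R : ℝ) ≤ dist u xf) (hzf : (R : ℝ) ≤ dist u zf)
    {c₀ cI : ℝ} (hc₀ : 0 ≤ c₀) (hc₀' : c₀ ≤ 1 / 2) (hcI : 2 * c₀ ≤ cI) (ε : ℕ → ℝ) (εr : ℝ)
    (hint : ∀ k ∈ E, ∀ᶠ L : ℕ in atTop,
      ENNReal.ofReal cI * finVolFourNrm (box 4 L) β u y y ≤ finVolIkMass (box 4 L) β u y (ℓ k) (ℓ (k + 1)))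
    (hmix : ∀ s ∈ E, ∀ᶠ L : ℕ in atTop, ∀ Φ Ψ : Current.FourCfg (boxGraph (box 4 L)) → ℝ≥0∞,
      (∀ pq, Φ pq ≤ 1) → (∀ pq, Ψ pq ≤ 1) →
      Current.FourLocal (latEdgesWithin (box 4 L) u (ℓ (s - 1))) Φ →
      Current.FourLocal (latEdgesBeyond (box 4 L) u (ℓ s)) Ψ →
      finVolFourMass (box 4 L) β u y y (Φ * Ψ) * finVolFourNrm (box 4 L) β u y y ≤
        finVolFourMass (box 4 L) β u y y Φ * finVolFourMass (box 4 L) β u y y Ψ +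
          ENNReal.ofReal (ε s) * finVolFourNrm (box 4 L) β u y y ^ 2)
    (hε : ∀ s ∈ E, ε s ≤ c₀ * (1 - c₀) ^ #(E.filter (· < s)))
    (hrel : ∀ᶠ L : ℕ in atTop, ∀ Φ : Current.FourCfg (boxGraph (box 4 L)) → ℝ≥0∞, (∀ pq, Φ pq ≤ 1) →
      Current.FourLocal (latEdgesWithin (box 4 L) u R) Φ →
      finVolFourMass (box 4 L) β u xf zf Φ * finVolFourNrm (box 4 L) β u y y ≤
        finVolFourMass (box 4 L) β u y y Φ * finVolFourNrm (box 4 L) β u xf zf +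
          ENNReal.ofReal εr * (finVolFourNrm (box 4 L) β u xf zf * finVolFourNrm (box 4 L) β u y y))
    (θ : ℕ) (yo tw : Site 4) :
    ∀ᶠ L : ℕ in atTop, ∀ (hu : u ∈ box 4 L) (hxf' : xf ∈ box 4 L) (hyo : yo ∈ box 4 L) (hzf' : zf ∈ box 4 L)
      (htw : tw ∈ box 4 L),
      Current.clusteringMassLT (G := boxGraph (box 4 L)) (fun _ => β) ℓ K θ ⟨xf, hxf'⟩ ⟨yo, hyo⟩ ⟨zf, hzf'⟩
          ⟨tw, htw⟩ ⟨u, hu⟩ ≤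
        ((#E).choose (#E + 1 - θ) : ℝ≥0∞) * (ENNReal.ofReal ((1 - c₀) ^ (#E + 1 - θ)) + ENNReal.ofReal εr) *
          (ecurrentSum (fun _ : (boxGraph (box 4 L)).edgeFinset => β) ({⟨yo, hyo⟩} ∆ {⟨u, hu⟩}) *
            ecurrentSum (fun _ : (boxGraph (box 4 L)).edgeFinset => β) ({⟨xf, hxf'⟩} ∆ {⟨u, hu⟩}) *
            (ecurrentSum (fun _ : (boxGraph (box 4 L)).edgeFinset => β) ({⟨tw, htw⟩} ∆ {⟨u, hu⟩}) *
              ecurrentSum (fun _ : (boxGraph (box 4 L)).edgeFinset => β) ({⟨zf, hzf'⟩} ∆ {⟨u, hu⟩}))) := by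
  have hymem : ∀ᶠ L : ℕ in atTop, y ∈ box 4 L := eventually_mem_box y
  filter_upwards [hymem, E.eventually_all.2 hint, E.eventually_all.2 hmix, hrel] with L hy hI hM hRl
  intro hu hxf' hyo hzf' htw
  have hK : ∀ e : (boxGraph (box 4 L)).edgeFinset, 0 ≤ (fun _ : (boxGraph (box 4 L)).edgeFinset => β) e :=
    fun _ => hβ.le
  -- positivity of the normalisation at `y`
  have hNy : Current.fourNrm (G := boxGraph (box 4 L)) (fun _ => β) ⟨u, hu⟩ ⟨y, hy⟩ ⟨y, hy⟩ ≠ 0 := by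
    unfold Current.fourNrm
    have hZ0 : ecurrentSum (fun _ : (boxGraph (box 4 L)).edgeFinset => β) (∅ : Finset ↥(box 4 L)) ≠ 0 :=
      ecurrentSum_empty_ne_zero _
    have hZy : ecurrentSum (fun _ : (boxGraph (box 4 L)).edgeFinset => β)
        ({(⟨y, hy⟩ : ↥(box 4 L))} ∆ {⟨u, hu⟩}) ≠ 0 := ecurrentSum_pair_ne_zero_box hβ ⟨y, hy⟩ ⟨u, hu⟩
    exact mul_ne_zero (mul_ne_zero hZ0 hZy) (mul_ne_zero hZ0 hZy)
  -- distances from `u` in the subtype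
  have hxR : (R : ℝ) ≤ dist (⟨u, hu⟩ : ↥(box 4 L)) ⟨xf, hxf'⟩ := by rw [Subtype.dist_eq]; exact hxf
  have hzR : (R : ℝ) ≤ dist (⟨u, hu⟩ : ↥(box 4 L)) ⟨zf, hzf'⟩ := by rw [Subtype.dist_eq]; exact hzf
  -- the dictionary for the edge sets and the masses
  have hWi : ∀ r, latEdgesWithin (box 4 L) u r = Current.edgesWithin (G := boxGraph (box 4 L)) ⟨u, hu⟩ r :=
    fun r => latEdgesWithin_eq hu r
  have hBe : ∀ r, latEdgesBeyond (box 4 L) u r = Current.edgesBeyond (G := boxGraph (box 4 L)) ⟨u, hu⟩ r :=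
    fun r => latEdgesBeyond_eq hu r
  have hMy : ∀ Φ, finVolFourMass (box 4 L) β u y y Φ =
      Current.fourMass (G := boxGraph (box 4 L)) (fun _ => β) ⟨u, hu⟩ ⟨y, hy⟩ ⟨y, hy⟩ Φ :=
    fun Φ => finVolFourMass_eq β hu hy hy Φ
  have hMxz : ∀ Φ, finVolFourMass (box 4 L) β u xf zf Φ =
      Current.fourMass (G := boxGraph (box 4 L)) (fun _ => β) ⟨u, hu⟩ ⟨xf, hxf'⟩ ⟨zf, hzf'⟩ Φ :=
    fun Φ => finVolFourMass_eq β hu hxf' hzf' Φ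
  have hNyy : finVolFourNrm (box 4 L) β u y y =
      Current.fourNrm (G := boxGraph (box 4 L)) (fun _ => β) ⟨u, hu⟩ ⟨y, hy⟩ ⟨y, hy⟩ := finVolFourNrm_eq β hu hy hy
  have hNxz : finVolFourNrm (box 4 L) β u xf zf =
      Current.fourNrm (G := boxGraph (box 4 L)) (fun _ => β) ⟨u, hu⟩ ⟨xf, hxf'⟩ ⟨zf, hzf'⟩ :=
    finVolFourNrm_eq β hu hxf' hzf'
  refine Current.clusteringMassLT_le_of_inputs hK (boxGraph_dist_step ⟨u, hu⟩) (boxGraph_dist_natCast ⟨u, hu⟩)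
    hℓ hE hgap hR hxR hzR hNy hc₀ hc₀' (fun s => ENNReal.ofReal (ε s)) (ENNReal.ofReal εr) ?_ ?_ ?_ ?_ θ
    ⟨yo, hyo⟩ ⟨tw, htw⟩
  · -- intersection property
    intro s hs
    have h := hI s hs
    rw [hNyy, finVolIkMass_eq β hu hy ℓ s] at h
    refine le_trans (mul_le_mul' (ENNReal.ofReal_le_ofReal hcI) le_rfl) h
  · -- mixing property
    intro s hs Φ Ψ hΦ hΨ hΦloc hΨloc
    rw [← hWi] at hΦloc
    rw [← hBe] at hΨloc
    have h := hM s hs Φ Ψ hΦ hΨ hΦloc hΨloc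
    rw [hMy, hMy, hMy, hNyy] at h
    exact h
  · -- error sizes
    intro s hs
    exact ENNReal.ofReal_le_ofReal (hε s hs)
  · -- relocation of the sources
    intro Φ hΦ hΦloc
    rw [← hWi] at hΦloc
    have h := hRl Φ hΦ hΦloc
    rw [hMxz, hMy, hNyy, hNxz] at h
    exact h

set_option maxHeartbeats 1600000 in
/-- **Aizenman–Duminil-Copin 2021, Theorem 1.3 (improved tree diagram bound) from Lemma 6.2 and
Theorem 6.4 in finite volume.** The three hypotheses are lattice statements about the nearest-neighbour
Ising model on `ℤ⁴` at `0 < β ≤ β_c`, each holding *eventually in the boxes `Λ_L` with free boundary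
condition as `L → ∞`* (the random-current representation of the tree being the finite-graph one; cf.
"we work with finite `Λ` and then take the limit", App. A.2), for the un-normalised four-current
expectations `finVolFourMass` of Part B (measure `P^{ua,ub,∅,∅}_{Λ_L}`, source layout of
`Current.fourAvoidMass K ∅ ({a}∆{u}) ∅ ({b}∆{u})`), with the window `N ≤ ξ(β)` written as in the tree
(`β = β_c ∨ (0 < β ∧ N ξ(β)⁻¹ ≤ 1)`, `ξ⁻¹ = invCorrLength (twoPointPlus 4 β)`):

* `Hint` — **Lemma 6.2 (intersection property)**: "there exists `c > 0` such that for every `β ≤ β_c`,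
  every `k`, and every `y ∉ Λ_{2ℓ_{k+1}}` in a regular scale, `P^{0y,0y,∅,∅}_β[I_k] ≥ c`", for two scales
  `2 ≤ a`, `a^{α₀} ≤ b` in the window with `B_b ≥ D₁ B_a` (the properties of `ℓ_k ≤ ℓ_{k+1}` used in its
  proof: "we used that `D` is large enough and Lemma 6.3"; `B_n = bubbleDiagram (twoPointFree 4 β) n`),
  centre `u`, far vertex `y` *central* in a `(c₀,C₀)`-regular scale `n` (`IsRegularScale`, Def. 5.11;
  `n ≤ ‖y-u‖ ≤ 2n` — the case produced below by Thm 5.12, where `y - u = 2^k e₁`; for such `y` and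
  `‖w-u‖ ≤ b < ‖y-u‖/2` the differences `y - w` stay in the regular annulus `Ann(n/2, 4n)` where P1/P2
  apply) and `‖y-u‖ > 2b`; the constants `α₀, D₁, c_I` may depend on the regularity constants `c₀, C₀`;
* `Hmix` — **Theorem 6.4, (6.8) (mixing)** for `s = 4` currents of which `t = 2` have the sources
  `{u,y}`, `{u,y}`: "for every `n^α ≤ N ≤ ξ(β)`, every `x_i ∈ Λ_n` and `y_i ∉ Λ_N`, and every events `E` and
  `F` depending on the restriction of `(n₁,…,n_s)` to edges within `Λ_n` and outside of `Λ_N`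
  respectively, `|P[E ∩ F] - P[E]P[F]| ≤ s(log N/n)^{-c}`", one-sided and for `[0,1]`-valued local
  functionals (`Current.FourLocal`, `latEdgesWithin`, `latEdgesBeyond`), with an additional threshold
  `n ≥ n₀`;
* `Hrel` — **Theorem 6.4, (6.9)**: "`|P^{x₁y₁,…}[E] - P^{x₁y'₁,…}[E]| ≤ s(log N/n)^{-c}`" for `E` local
  inside `Λ_n(u)` and far sources `x, z` resp. `y, y` (all at distance `≥ N` from `u`), in the cross-
  multiplied one-sided form `E^{ux,uz}[Φ]·N_{yy} ≤ E^{uy,uy}[Φ]·N_{xz} + ε N_{xz}N_{yy}`.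

CONCLUSION: the tree's named fact `aizenmanDuminilCopin_improvedTreeDiagramBound` (Thm 1.3 for the DLR
states of `ℤ⁴`). Proof: §6.1, p. 22, as printed — the dynamic scales `ℓ_k(β,D)` with `D` large
(`ℓ_{k+1} ≥ ℓ_k^α` by Lemma 6.3, `stateScale_pow_le_succ`), a regular `y ∈ Ann(ℓ_{K-1}, ℓ_K)` (Thm 5.12,
`exists_regularScale_between`), WLOG the far source of each pair, the even usable indices `≤ K-3`,
relocation of the sources `x, z ↦ y, y`, the induction with the intersection and mixing properties
(`Current.clusteringMassLT_le_of_inputs` through `clusteringMassLT_box_le_of_eventually`), the numerics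
(`choose_mul_add_le_two_rpow`), and finally `improvedTreeDiagramBound_of_boxClustering` (Thm 1.3 ⇐
finite-volume Prop. 6.1). [cite: AizenmanDuminilCopinAnnals2021, arXiv:1912.07973 Thm 1.3 (p. 6); §6.1: Prop. 6.1, Lemma 6.2, Thm 6.4 and the proof of Prop. 6.1 (pp. 21–22)] -/
theorem improvedTreeDiagramBound_of_intersection_and_mixing
    (Hint : ∀ c₀ C₀ : ℝ, 0 < c₀ → 0 < C₀ → ∃ α₀ D₁ cI : ℝ, 0 < cI ∧
      ∀ β : ℝ, 0 < β → β ≤ criticalBeta 4 → ∀ a b : ℕ, 2 ≤ a → (a : ℝ) ^ α₀ ≤ b →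
        (β = criticalBeta 4 ∨ (0 < β ∧ (b : ℝ) * invCorrLength (twoPointPlus 4 β) ≤ 1)) →
        D₁ * bubbleDiagram (twoPointFree 4 β) a ≤ bubbleDiagram (twoPointFree 4 β) b →
        ∀ u y : Site 4, (∃ n : ℕ, IsRegularScale (twoPointFree 4 β) c₀ C₀ n ∧
            (n : ℝ) ≤ dist u y ∧ dist u y ≤ 2 * n) → (2 * b : ℝ) < dist u y →
        ∀ᶠ L : ℕ in atTop,
          ENNReal.ofReal cI * finVolFourNrm (box 4 L) β u y y ≤ finVolIkMass (box 4 L) β u y a b)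
    (Hmix : ∃ α c C : ℝ, ∃ n₀ : ℕ, 0 < c ∧ 0 < C ∧
      ∀ β : ℝ, 0 < β → β ≤ criticalBeta 4 → ∀ u y : Site 4, ∀ n N : ℕ, n₀ ≤ n → (n : ℝ) ^ α ≤ N →
        (β = criticalBeta 4 ∨ (0 < β ∧ (N : ℝ) * invCorrLength (twoPointPlus 4 β) ≤ 1)) →
        (N : ℝ) ≤ dist u y →
        ∀ᶠ L : ℕ in atTop, ∀ Φ Ψ : Current.FourCfg (boxGraph (box 4 L)) → ℝ≥0∞,
          (∀ pq, Φ pq ≤ 1) → (∀ pq, Ψ pq ≤ 1) →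
          Current.FourLocal (latEdgesWithin (box 4 L) u n) Φ →
          Current.FourLocal (latEdgesBeyond (box 4 L) u N) Ψ →
          finVolFourMass (box 4 L) β u y y (Φ * Ψ) * finVolFourNrm (box 4 L) β u y y ≤
            finVolFourMass (box 4 L) β u y y Φ * finVolFourMass (box 4 L) β u y y Ψ +
              ENNReal.ofReal (C * Real.log ((N : ℝ) / n) ^ (-c)) * finVolFourNrm (box 4 L) β u y y ^ 2)
    (Hrel : ∃ α c C : ℝ, ∃ n₀ : ℕ, 0 < c ∧ 0 < C ∧
      ∀ β : ℝ, 0 < β → β ≤ criticalBeta 4 → ∀ u x z y : Site 4, ∀ n N : ℕ, n₀ ≤ n → (n : ℝ) ^ α ≤ N →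
        (β = criticalBeta 4 ∨ (0 < β ∧ (N : ℝ) * invCorrLength (twoPointPlus 4 β) ≤ 1)) →
        (N : ℝ) ≤ dist u x → (N : ℝ) ≤ dist u z → (N : ℝ) ≤ dist u y →
        ∀ᶠ L : ℕ in atTop, ∀ Φ : Current.FourCfg (boxGraph (box 4 L)) → ℝ≥0∞, (∀ pq, Φ pq ≤ 1) →
          Current.FourLocal (latEdgesWithin (box 4 L) u n) Φ →
          finVolFourMass (box 4 L) β u x z Φ * finVolFourNrm (box 4 L) β u y y ≤
            finVolFourMass (box 4 L) β u y y Φ * finVolFourNrm (box 4 L) β u x z +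
              ENNReal.ofReal (C * Real.log ((N : ℝ) / n) ^ (-c)) *
                (finVolFourNrm (box 4 L) β u x z * finVolFourNrm (box 4 L) β u y y)) :
    aizenmanDuminilCopin_improvedTreeDiagramBound := by
  classical
  obtain ⟨D₀, hD₀1, hAsm⟩ := improvedTreeDiagramBound_of_boxClustering
  obtain ⟨αm, cm, Cm, n₀m, hcm, hCm, hMix⟩ := Hmix
  obtain ⟨αr, cr, Cr, n₀r, hcr, hCr, hRel⟩ := Hrel
  obtain ⟨c₀r, C₀r, M₀, hc₀r, hC₀r, hReg⟩ := exists_regularScale_between (α := 3) (by norm_num)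
  obtain ⟨α₀, D₁, cI, hcI, hInt⟩ := Hint c₀r C₀r hc₀r hC₀r
  obtain ⟨Cg, hCg, hScales⟩ := stateScale_log_growth
  /- ### The constants -/
  -- `c₀` and the numerics `δ₁`
  set c₀ : ℝ := min (cI / 2) (1 / 4) with hc₀def
  have hc₀pos : 0 < c₀ := lt_min (by linarith) (by norm_num)
  have hc₀le : c₀ ≤ 1 / 4 := min_le_right _ _
  have hc₀cI : 2 * c₀ ≤ cI := by have := min_le_left (cI / 2) (1 / 4); linarith
  obtain ⟨δ₁, hδ₁, hδ₁16, hNum⟩ :=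
    exists_delta_choose_mul_pow_le_exp_neg (q := 1 - c₀) (by linarith) (by linarith)
  -- `ρ` (target rate of the relocation error) and `α`
  set ρ : ℝ := Real.exp (-δ₁) * (2 : ℝ) ^ (-(1 / 2 : ℝ)) with hρ
  have hρpos : 0 < ρ := by positivity
  set α : ℝ := max (max (max 3 αm) (max αr α₀)) (max ((1 - c₀) ^ (-(1 / (2 * cm)))) (ρ ^ (-(1 / cr))))
    with hαdef
  have hα3 : 3 ≤ α := le_trans (le_trans (le_max_left _ _) (le_max_left _ _)) (le_max_left _ _)
  have hααm : αm ≤ α := le_trans (le_trans (le_max_right _ _) (le_max_left _ _)) (le_max_left _ _)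
  have hααr : αr ≤ α := le_trans (le_trans (le_max_left _ _) (le_max_right _ _)) (le_max_left _ _)
  have hαα₀ : α₀ ≤ α := le_trans (le_trans (le_max_right _ _) (le_max_right _ _)) (le_max_left _ _)
  have hαA1 : (1 - c₀) ^ (-(1 / (2 * cm))) ≤ α := le_trans (le_max_left _ _) (le_max_right _ _)
  have hαA2 : ρ ^ (-(1 / cr)) ≤ α := le_trans (le_max_right _ _) (le_max_right _ _)
  have hα1 : 1 < α := by linarith
  have hα1' : 1 ≤ α := hα1.le
  have hα0 : 0 < α := by linarith
  have hR1 : α ^ (-(2 * cm)) ≤ 1 - c₀ := rpow_neg_le_of_ge (by positivity) (by linarith) hαA1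
  have hR2 : α ^ (-cr) ≤ ρ := rpow_neg_le_of_ge hcr hρpos hαA2
  -- the threshold `T` for `log ℓ₁`
  set T : ℝ := max 1 (max ((Cm / c₀) ^ (1 / cm) / (α - 1)) ((Cr / ρ ^ 3) ^ (1 / cr) / (α - 1))) with hTdef
  have hT1 : 1 ≤ T := le_max_left _ _
  have hTpos : 0 < T := by linarith
  have hTm : Cm * ((α - 1) * T) ^ (-cm) ≤ c₀ := by
    refine const_mul_rpow_neg_le_of_ge hCm hcm hc₀pos ?_
    have h : (Cm / c₀) ^ (1 / cm) / (α - 1) ≤ T := le_trans (le_max_left _ _) (le_max_right _ _)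
    rw [div_le_iff₀ (by linarith)] at h
    linarith
  have hTr : Cr * ((α - 1) * T) ^ (-cr) ≤ ρ ^ 3 := by
    refine const_mul_rpow_neg_le_of_ge hCr hcr (by positivity) ?_
    have h : (Cr / ρ ^ 3) ^ (1 / cr) / (α - 1) ≤ T := le_trans (le_max_right _ _) (le_max_right _ _)
    rw [div_le_iff₀ (by linarith)] at h
    linarith
  -- the size of `ℓ₁` and `D`
  set nmin : ℕ := max (max n₀m n₀r) (max ⌈M₀⌉₊ ⌈Real.exp T⌉₊) with hnmin
  set D : ℝ := max (max (max D₀ D₁) (max 82 (1 + Cg * (α + 1)))) ((2 * (nmin : ℝ) + 1) ^ 4 + 1) with hDdef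
  have hDD₀ : D₀ ≤ D := le_trans (le_trans (le_max_left _ _) (le_max_left _ _)) (le_max_left _ _)
  have hDD₁ : D₁ ≤ D := le_trans (le_trans (le_max_right _ _) (le_max_left _ _)) (le_max_left _ _)
  have hD82 : 82 ≤ D := le_trans (le_trans (le_max_left _ _) (le_max_right _ _)) (le_max_left _ _)
  have hDα : 1 + Cg * (α + 1) ≤ D := le_trans (le_trans (le_max_right _ _) (le_max_right _ _)) (le_max_left _ _)
  have hDn : (2 * (nmin : ℝ) + 1) ^ 4 < D := lt_of_lt_of_le (by linarith) (le_max_right _ _)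
  set δ : ℝ := δ₁ / 2 with hδdef
  have hδpos : 0 < δ := by positivity
  refine hAsm D hDD₀ δ hδpos ?_
  /- ### The clustering bound in the boxes -/
  intro β K hβ hβc hK3 μ hμ hinf hwin x u hdistx θ hθ
  have hβc0 : 0 < criticalBeta 4 := criticalBeta_pos_holds (d := 4) (by norm_num)
  have hβpos : 0 < β := by
    rcases hwin with h | h
    · rw [h]; exact hβc0
    · exact h.1
  haveI : IsProbabilityMeasure μ := (isingGibbsMeasure_twoPoint_four hβ hβc hμ).1
  have hgks : ∀ {Λ A : Finset (Site 4)} {β h : ℝ} {bc : BoundaryCondition (Site 4)},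
      gks_one (zdGraph 4) (Λ := Λ) (A := A) (β := β) (h := h) (bc := bc) :=
    GKSInequalities.gks_one_holds (zdGraph 4)
  -- the scales: everything we need about `ℓ_k = stateScale μ D k`, then we make `ℓ` opaque
  obtain ⟨htwo, hlogstep, hlogchain⟩ := hScales α D hα1' hD82 hDα β hβ hβc μ hμ K hinf hwin
  have hK0 : 0 < K := by omega
  have hℓmono : Monotone (stateScale μ D) := stateScale_monotone μ (by linarith)
  have hℓ1 : nmin < stateScale μ D 1 := lt_stateScale_one μ hDn (hinf 0 hK0)
  have hDB : ∀ k, k < K → D * bubbleDiagram (twoPoint μ spinAt 0) ((stateScale μ D k : ℕ) : ℝ) ≤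
      bubbleDiagram (twoPoint μ spinAt 0) ((stateScale μ D (k + 1) : ℕ) : ℝ) := fun k hk =>
    mul_le_apply_dynScale_succ (B := fun n : ℕ => bubbleDiagram (twoPoint μ spinAt 0) (n : ℝ)) (D := D) (hinf k hk)
  have hℓ0 : stateScale μ D 0 = 0 := rfl
  clear hinf
  generalize stateScale μ D = ℓ at htwo hlogstep hlogchain hℓmono hℓ1 hDB hℓ0 hwin hdistx ⊢
  have hn₀m : n₀m ≤ ℓ 1 := by
    have : n₀m ≤ nmin := le_trans (le_max_left _ _) (le_max_left _ _)
    omega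
  have hn₀r : n₀r ≤ ℓ 1 := by
    have : n₀r ≤ nmin := le_trans (le_max_right _ _) (le_max_left _ _)
    omega
  have hM₀ : M₀ ≤ ℓ 1 := by
    have h1 : ⌈M₀⌉₊ ≤ nmin := le_trans (le_max_left _ _) (le_max_right _ _)
    have h2 : (⌈M₀⌉₊ : ℝ) ≤ ℓ 1 := by exact_mod_cast h1.trans hℓ1.le
    exact (Nat.le_ceil M₀).trans h2
  have hTlog : T ≤ Real.log (ℓ 1) := by
    have h1 : ⌈Real.exp T⌉₊ ≤ nmin := le_trans (le_max_right _ _) (le_max_right _ _)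
    have h2 : (⌈Real.exp T⌉₊ : ℝ) ≤ ℓ 1 := by exact_mod_cast h1.trans hℓ1.le
    have h3 : Real.exp T ≤ ℓ 1 := (Nat.le_ceil _).trans h2
    rw [Real.le_log_iff_exp_le (lt_of_lt_of_le (Real.exp_pos T) h3)]
    exact h3
  -- power growth for any exponent `γ ≤ α`
  have hpowle : ∀ k, 1 ≤ k → k < K → ∀ γ : ℝ, γ ≤ α → ((ℓ k : ℕ) : ℝ) ^ γ ≤ ℓ (k + 1) := by
    intro k hk1 hkK γ hγα
    have h2 : (2 : ℝ) ≤ ℓ k := by exact_mod_cast htwo k hk1 hkK.le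
    have h2' : (2 : ℝ) ≤ ℓ (k + 1) := by exact_mod_cast htwo (k + 1) (by omega) (by omega)
    have hpos : (0 : ℝ) < ℓ k := by linarith
    have hpos' : (0 : ℝ) < ℓ (k + 1) := by linarith
    rcases le_or_gt γ 0 with hγ | hγ
    · calc ((ℓ k : ℕ) : ℝ) ^ γ ≤ 1 := Real.rpow_le_one_of_one_le_of_nonpos (by linarith) hγ
        _ ≤ ℓ (k + 1) := by linarith
    · rw [← Real.log_le_log_iff (Real.rpow_pos_of_pos hpos γ) hpos', Real.log_rpow hpos]
      calc γ * Real.log (ℓ k) ≤ α * Real.log (ℓ k) :=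
            mul_le_mul_of_nonneg_right hγα (Real.log_nonneg (by linarith))
        _ ≤ Real.log (ℓ (k + 1)) := hlogstep k hk1 hkK
  -- membership of the points in the boxes, eventually
  have hmem : ∀ᶠ n : ℕ in atTop, u ∈ box 4 n ∧ ∀ i, x i ∈ box 4 n :=
    (eventually_mem_box u).and (eventually_all.2 fun i => eventually_mem_box (x i))
  /- ### Small thresholds are vacuous -/
  by_cases hθ1 : θ ≤ 1
  · filter_upwards [hmem] with n hn
    have h0 : finVolClusteringRatio (box 4 n) β ℓ K θ (x 0) (x 1) (x 2) (x 3) u = 0 := by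
      unfold finVolClusteringRatio
      rw [dif_pos ⟨hn.2 0, hn.2 1, hn.2 2, hn.2 3, hn.1⟩,
        Current.clusteringMassLT_eq_zero_of_le_one _ hℓ0 K hθ1, ENNReal.toReal_zero, zero_div]
    rw [h0]
    exact mul_nonneg (Real.rpow_nonneg (by norm_num) _)
      (Finset.prod_nonneg fun j _ => isingTwoPoint_free_nonneg hgks hβ hn.1 (hn.2 j))
  /- ### The main case `θ ≥ 2` -/
  have hθ2 : 2 ≤ θ := by omega
  have hδK2 : (2 : ℝ) ≤ δ * K := le_trans (by exact_mod_cast hθ2) hθ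
  have hδ₁K4 : 4 ≤ δ₁ * K := by rw [hδdef] at hδK2; linarith
  have hK64 : (64 : ℝ) ≤ K := by nlinarith
  have hK64' : 64 ≤ K := by exact_mod_cast hK64
  -- the usable indices
  set J : ℕ := (K - 3) / 2 with hJ
  have hEK : ∀ k ∈ evenIndices J, 2 ≤ k ∧ k + 3 ≤ K := fun k hk => two_le_of_mem_evenIndices hk
  have hEsub : evenIndices J ⊆ range (K + 1) := fun k hk => mem_range.2 (by have := (hEK k hk).2; omega)
  have hgap := evenIndices_gap (J := J)
  have hcardE : #(evenIndices J) = J := card_evenIndices J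
  have hRE : ∀ k ∈ evenIndices J, ℓ (k + 1) ≤ ℓ (K - 2) := fun k hk => hℓmono (by have := (hEK k hk).2; omega)
  -- the far source of each pair
  have hfar : ∀ a b : Site 4, 2 * (ℓ K : ℝ) < dist a b → (ℓ K : ℝ) < dist u a ∨ (ℓ K : ℝ) < dist u b := by
    intro a b hab
    by_contra h
    push Not at h
    have := dist_triangle_left a b u
    linarith
  have h01 : (ℓ K : ℝ) < dist u (x 0) ∨ (ℓ K : ℝ) < dist u (x 1) :=
    hfar _ _ (by have := hdistx 0 1 (by decide); rwa [← dist_eq_norm] at this)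
  have h23 : (ℓ K : ℝ) < dist u (x 2) ∨ (ℓ K : ℝ) < dist u (x 3) :=
    hfar _ _ (by have := hdistx 2 3 (by decide); rwa [← dist_eq_norm] at this)
  -- a regular far vertex `y ∈ Ann(ℓ_{K-1}, ℓ_K)`
  have hℓK1 : 2 ≤ ℓ (K - 1) := htwo (K - 1) (by omega) (by omega)
  have hpowK : ((ℓ (K - 1) : ℕ) : ℝ) ^ (3 : ℝ) ≤ ℓ K := by
    have := hpowle (K - 1) (by omega) (by omega) 3 hα3
    rwa [show K - 1 + 1 = K by omega] at this
  have hM₀K : M₀ * (ℓ (K - 1) : ℝ) ≤ ℓ K := by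
    have ha1 : (1 : ℝ) ≤ ℓ (K - 1) := by exact_mod_cast (by omega : 1 ≤ ℓ (K - 1))
    have ha0 : (0 : ℝ) ≤ ℓ (K - 1) := by linarith
    have hMa : M₀ ≤ ℓ (K - 1) := hM₀.trans (by exact_mod_cast hℓmono (by omega : 1 ≤ K - 1))
    have hcube : ((ℓ (K - 1) : ℕ) : ℝ) ^ (3 : ℝ) = (ℓ (K - 1) : ℝ) ^ (3 : ℕ) := by
      rw [← Real.rpow_natCast]; norm_num
    rw [hcube] at hpowK
    calc M₀ * (ℓ (K - 1) : ℝ) ≤ (ℓ (K - 1) : ℝ) * ℓ (K - 1) := mul_le_mul_of_nonneg_right hMa ha0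
      _ ≤ (ℓ (K - 1) : ℝ) * ℓ (K - 1) * ℓ (K - 1) := le_mul_of_one_le_right (by positivity) ha1
      _ = (ℓ (K - 1) : ℝ) ^ (3 : ℕ) := by ring
      _ ≤ ℓ K := hpowK
  obtain ⟨k₀, hk₀lo, -, hk₀reg⟩ := hReg β hβpos hβc (ℓ (K - 1)) (ℓ K) (by omega) hpowK hM₀K hwin
  set y : Site 4 := u + Pi.single (0 : Fin 4) ((2 ^ k₀ : ℕ) : ℤ) with hydef
  have hyu : y - u = Pi.single (0 : Fin 4) ((2 ^ k₀ : ℕ) : ℤ) := by rw [hydef]; abel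
  have hdy : dist u y = ((2 ^ k₀ : ℕ) : ℝ) := by
    rw [dist_comm, Site.dist_eq_supNorm, hyu, Site.supNorm_single]
    simp
  have hyreg : ∃ n : ℕ, IsRegularScale (twoPointFree 4 β) c₀r C₀r n ∧ (n : ℝ) ≤ dist u y ∧ dist u y ≤ 2 * n :=
    ⟨2 ^ k₀, hk₀reg, by rw [hdy], by rw [hdy]; linarith [(Nat.cast_nonneg (2 ^ k₀) : (0 : ℝ) ≤ _)]⟩
  have hyfar : (ℓ (K - 1) : ℝ) ≤ dist u y := by rw [hdy]; exact_mod_cast hk₀lo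
  -- the bubble diagram of the state is that of the free two-point function
  have hBfree : ∀ n : ℕ, bubbleDiagram (twoPointFree 4 β) (n : ℝ) = bubbleDiagram (twoPoint μ spinAt 0) (n : ℝ) := by
    intro n
    have hS : twoPointFree 4 β = twoPoint μ spinAt 0 := funext fun v => (twoPoint_zero_eq_twoPointFree hβ hβc hμ v).symm
    rw [hS]
  -- the window below `ℓ_K`
  have hwinle : ∀ m : ℕ, m ≤ ℓ K → (β = criticalBeta 4 ∨ (0 < β ∧ (m : ℝ) * invCorrLength (twoPointPlus 4 β) ≤ 1)) :=
    fun m hm => adcWindow_mono hβ hwin (by exact_mod_cast hm)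
  -- strict doubling two scales below the top: `2ℓ_{K-2} < ℓ_{K-1}`
  have h2K2 : 2 * (ℓ (K - 2) : ℝ) < ℓ (K - 1) := by
    have h := hpowle (K - 2) (by omega) (by omega) 3 hα3
    rw [show K - 2 + 1 = K - 1 by omega] at h
    have h2 : (2 : ℝ) ≤ ℓ (K - 2) := by exact_mod_cast htwo (K - 2) (by omega) (by omega)
    have hcube : ((ℓ (K - 2) : ℕ) : ℝ) ^ (3 : ℝ) = (ℓ (K - 2) : ℝ) ^ (3 : ℕ) := by
      rw [← Real.rpow_natCast]; norm_num
    rw [hcube] at h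
    have h0 : (0 : ℝ) ≤ ℓ (K - 2) := by linarith
    have hsq : (4 : ℝ) ≤ (ℓ (K - 2) : ℝ) * ℓ (K - 2) := by
      have := mul_le_mul h2 h2 (by norm_num) h0
      linarith
    have h3 : (4 : ℝ) * ℓ (K - 2) ≤ (ℓ (K - 2) : ℝ) ^ (3 : ℕ) := by
      rw [show (ℓ (K - 2) : ℝ) ^ (3 : ℕ) = (ℓ (K - 2) : ℝ) * ℓ (K - 2) * ℓ (K - 2) by ring]
      exact mul_le_mul_of_nonneg_right hsq h0
    linarith
  /- ### The sizes of the errors -/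
  have hε : ∀ s ∈ evenIndices J, Cm * Real.log ((ℓ s : ℝ) / (ℓ (s - 1))) ^ (-cm) ≤
      c₀ * (1 - c₀) ^ #((evenIndices J).filter (· < s)) := by
    intro s hs
    obtain ⟨i, hi, rfl⟩ := mem_evenIndices.1 hs
    obtain ⟨-, hs3⟩ := hEK _ hs
    rw [evenIndices_filter_lt hi, card_evenIndices, show 2 * i + 2 - 1 = 2 * i + 1 by omega]
    -- the lower bound on `log(ℓ_s/ℓ_{s-1})`
    have hchain := hlogchain (2 * i) (by omega)
    rw [show 1 + 2 * i = 2 * i + 1 by omega] at hchain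
    have hstep := hlogstep (2 * i + 1) (by omega) (by omega)
    rw [show 2 * i + 1 + 1 = 2 * i + 2 by omega] at hstep
    have ha : (2 : ℝ) ≤ ℓ (2 * i + 1) := by exact_mod_cast htwo (2 * i + 1) (by omega) (by omega)
    have hb : (2 : ℝ) ≤ ℓ (2 * i + 2) := by exact_mod_cast htwo (2 * i + 2) (by omega) (by omega)
    have hx : (α - 1) * α ^ (2 * i) * T ≤ Real.log ((ℓ (2 * i + 2) : ℝ) / ℓ (2 * i + 1)) := by
      rw [Real.log_div (by linarith : (0 : ℝ) < ℓ (2 * i + 2)).ne' (by linarith : (0 : ℝ) < ℓ (2 * i + 1)).ne']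
      have hα1'' : 0 ≤ α - 1 := by linarith
      have hαi : 0 ≤ α ^ (2 * i) := pow_nonneg hα0.le _
      have h1 : (α - 1) * α ^ (2 * i) * T ≤ (α - 1) * α ^ (2 * i) * Real.log (ℓ 1) :=
        mul_le_mul_of_nonneg_left hTlog (mul_nonneg hα1'' hαi)
      have h2 : (α - 1) * (α ^ (2 * i) * Real.log (ℓ 1)) ≤ (α - 1) * Real.log (ℓ (2 * i + 1)) :=
        mul_le_mul_of_nonneg_left hchain hα1''
      have h3 : (α - 1) * (α ^ (2 * i) * Real.log (ℓ 1)) = (α - 1) * α ^ (2 * i) * Real.log (ℓ 1) := by ring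
      have h4 : (α - 1) * Real.log (ℓ (2 * i + 1)) = α * Real.log (ℓ (2 * i + 1)) - Real.log (ℓ (2 * i + 1)) := by
        ring
      linarith
    have h := const_mul_rpow_neg_le hCm.le hcm.le hα1 hTpos hTm (2 * i) hx
    refine h.trans (mul_le_mul_of_nonneg_left ?_ hc₀pos.le)
    have hsq : (α ^ (-cm)) ^ 2 = α ^ (-(2 * cm)) := by
      rw [← Real.rpow_natCast, ← Real.rpow_mul hα0.le]
      congr 1
      push_cast
      ring
    calc (α ^ (-cm)) ^ (2 * i) = ((α ^ (-cm)) ^ 2) ^ i := pow_mul _ 2 i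
      _ = (α ^ (-(2 * cm))) ^ i := by rw [hsq]
      _ ≤ (1 - c₀) ^ i := pow_le_pow_left₀ (Real.rpow_nonneg hα0.le _) hR1 i
  obtain ⟨εr, hεrdef⟩ : ∃ εr : ℝ, εr = Cr * Real.log ((ℓ (K - 1) : ℝ) / (ℓ (K - 2))) ^ (-cr) := ⟨_, rfl⟩
  have hεr0 : 0 ≤ εr := by
    rw [hεrdef]
    have ha : (2 : ℝ) ≤ ℓ (K - 2) := by exact_mod_cast htwo (K - 2) (by omega) (by omega)
    have hab : (ℓ (K - 2) : ℝ) ≤ ℓ (K - 1) := by exact_mod_cast hℓmono (by omega : K - 2 ≤ K - 1)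
    have hlog : 0 ≤ Real.log ((ℓ (K - 1) : ℝ) / (ℓ (K - 2))) := by
      refine Real.log_nonneg ?_
      rw [le_div_iff₀ (by linarith), one_mul]
      exact hab
    exact mul_nonneg hCr.le (Real.rpow_nonneg hlog _)
  have hεr : (2 : ℝ) ^ ((K : ℝ) / 2) * εr ≤ Real.exp (-(δ₁ * K)) := by
    -- `log(ℓ_{K-1}/ℓ_{K-2}) ≥ (α-1) α^{K-3} T`
    have hchain := hlogchain (K - 3) (by omega)
    rw [show 1 + (K - 3) = K - 2 by omega] at hchain
    have hstep := hlogstep (K - 2) (by omega) (by omega)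
    rw [show K - 2 + 1 = K - 1 by omega] at hstep
    have ha : (2 : ℝ) ≤ ℓ (K - 2) := by exact_mod_cast htwo (K - 2) (by omega) (by omega)
    have hb : (2 : ℝ) ≤ ℓ (K - 1) := by exact_mod_cast htwo (K - 1) (by omega) (by omega)
    have hx : (α - 1) * α ^ (K - 3) * T ≤ Real.log ((ℓ (K - 1) : ℝ) / ℓ (K - 2)) := by
      rw [Real.log_div (by linarith : (0 : ℝ) < ℓ (K - 1)).ne' (by linarith : (0 : ℝ) < ℓ (K - 2)).ne']
      have hα1'' : 0 ≤ α - 1 := by linarith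
      have hαi : 0 ≤ α ^ (K - 3) := pow_nonneg hα0.le _
      have h1 : (α - 1) * α ^ (K - 3) * T ≤ (α - 1) * α ^ (K - 3) * Real.log (ℓ 1) :=
        mul_le_mul_of_nonneg_left hTlog (mul_nonneg hα1'' hαi)
      have h2 : (α - 1) * (α ^ (K - 3) * Real.log (ℓ 1)) ≤ (α - 1) * Real.log (ℓ (K - 2)) :=
        mul_le_mul_of_nonneg_left hchain hα1''
      have h3 : (α - 1) * (α ^ (K - 3) * Real.log (ℓ 1)) = (α - 1) * α ^ (K - 3) * Real.log (ℓ 1) := by ring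
      have h4 : (α - 1) * Real.log (ℓ (K - 2)) = α * Real.log (ℓ (K - 2)) - Real.log (ℓ (K - 2)) := by ring
      linarith
    have h := const_mul_rpow_neg_le hCr.le hcr.le hα1 hTpos hTr (K - 3) hx
    -- `εr ≤ ρ^3 (α^{-cr})^{K-3} ≤ ρ^K`
    have hρK : εr ≤ ρ ^ K :=
      calc εr = Cr * Real.log ((ℓ (K - 1) : ℝ) / ℓ (K - 2)) ^ (-cr) := hεrdef
        _ ≤ ρ ^ 3 * (α ^ (-cr)) ^ (K - 3) := h
        _ ≤ ρ ^ 3 * ρ ^ (K - 3) :=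
            mul_le_mul_of_nonneg_left (pow_le_pow_left₀ (Real.rpow_nonneg hα0.le _) hR2 _) (by positivity)
        _ = ρ ^ K := by rw [← pow_add, show 3 + (K - 3) = K by omega]
    -- `2^{K/2} ρ^K = e^{-δ₁K}`
    have hρpow : (2 : ℝ) ^ ((K : ℝ) / 2) * ρ ^ K = Real.exp (-(δ₁ * K)) := by
      rw [hρ, mul_pow, ← Real.exp_nat_mul, ← Real.rpow_natCast ((2 : ℝ) ^ (-(1 / 2 : ℝ))) K,
        ← Real.rpow_mul (by norm_num : (0 : ℝ) ≤ 2)]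
      rw [show (K : ℝ) * -δ₁ = -(δ₁ * K) by ring, show -(1 / 2 : ℝ) * K = -((K : ℝ) / 2) by ring,
        Real.rpow_neg (by norm_num : (0 : ℝ) ≤ 2)]
      have h2 : (0 : ℝ) < (2 : ℝ) ^ ((K : ℝ) / 2) := Real.rpow_pos_of_pos (by norm_num) _
      field_simp
    calc (2 : ℝ) ^ ((K : ℝ) / 2) * εr ≤ (2 : ℝ) ^ ((K : ℝ) / 2) * ρ ^ K :=
          mul_le_mul_of_nonneg_left hρK (Real.rpow_nonneg (by norm_num) _)
      _ = Real.exp (-(δ₁ * K)) := hρpow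
  /- ### The numerics -/
  have hJ1 : (K : ℝ) / 2 - 2 ≤ J := by
    have h : K ≤ 2 * J + 4 := by rw [hJ]; omega
    have h' : (K : ℝ) ≤ 2 * J + 4 := by exact_mod_cast h
    linarith
  have hJ2 : J ≤ K := by rw [hJ]; omega
  have hJ3 : (J : ℝ) ≤ K / 2 := by
    have h : 2 * J ≤ K := by rw [hJ]; omega
    have h' : (2 : ℝ) * J ≤ K := by exact_mod_cast h
    linarith
  have hθ1' : 1 ≤ θ := by omega
  have hθδ₁ : (θ : ℝ) ≤ δ₁ * K / 2 := by rw [hδdef] at hθ; linarith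
  have hθJ : θ - 1 ≤ J := by
    have h1 : (θ : ℝ) ≤ (K : ℝ) / 32 := by nlinarith
    have h2 : (θ : ℝ) ≤ J := by linarith
    have h3 : θ ≤ J := by exact_mod_cast h2
    omega
  have hθδ : ((θ - 1 : ℕ) : ℝ) ≤ δ₁ * K := by
    have : ((θ - 1 : ℕ) : ℝ) ≤ θ := by exact_mod_cast Nat.sub_le θ 1
    linarith
  have hnum : (J.choose (J + 1 - θ) : ℝ) * ((1 - c₀) ^ (J + 1 - θ) + εr) ≤ (2 : ℝ) ^ (-(δ₁ * K / 2)) :=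
    choose_mul_add_le_two_rpow hNum (by omega) hJ1 hJ2 hJ3 hθ1' hθJ hθδ hδ₁K4 hεr0 hεr
  have hnum' : ((J.choose (J + 1 - θ) : ℕ) : ℝ≥0∞) * (ENNReal.ofReal ((1 - c₀) ^ (J + 1 - θ)) + ENNReal.ofReal εr) ≤
      ENNReal.ofReal ((2 : ℝ) ^ (-(δ * K))) := by
    have h1c : 0 ≤ (1 - c₀) ^ (J + 1 - θ) := pow_nonneg (by linarith) _
    rw [← ENNReal.ofReal_add h1c hεr0, ← ENNReal.ofReal_natCast, ← ENNReal.ofReal_mul (Nat.cast_nonneg _)]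
    refine ENNReal.ofReal_le_ofReal (hnum.trans (le_of_eq ?_))
    rw [hδdef]; ring_nf
  /- ### The three inputs, eventually in the boxes -/
  have EvInt : ∀ k ∈ evenIndices J, ∀ᶠ L : ℕ in atTop,
      ENNReal.ofReal cI * finVolFourNrm (box 4 L) β u y y ≤ finVolIkMass (box 4 L) β u y (ℓ k) (ℓ (k + 1)) := by
    intro k hk
    obtain ⟨hk2, hk3⟩ := hEK k hk
    refine hInt β hβpos hβc (ℓ k) (ℓ (k + 1)) (htwo k (by omega) (by omega))
      (hpowle k (by omega) (by omega) α₀ hαα₀) (hwinle _ (hℓmono (by omega))) ?_ u y hyreg ?_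
    · rw [hBfree, hBfree]
      have h := hDB k (by omega)
      have hB0 : 0 ≤ bubbleDiagram (twoPoint μ spinAt 0) ((ℓ k : ℕ) : ℝ) := bubbleDiagram_nonneg _ _
      calc D₁ * bubbleDiagram (twoPoint μ spinAt 0) ((ℓ k : ℕ) : ℝ)
          ≤ D * bubbleDiagram (twoPoint μ spinAt 0) ((ℓ k : ℕ) : ℝ) := mul_le_mul_of_nonneg_right hDD₁ hB0
        _ ≤ _ := h
    · have h1 : (ℓ (k + 1) : ℝ) ≤ ℓ (K - 2) := by exact_mod_cast hRE k hk
      linarith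
  have EvMix : ∀ s ∈ evenIndices J, ∀ᶠ L : ℕ in atTop, ∀ Φ Ψ : Current.FourCfg (boxGraph (box 4 L)) → ℝ≥0∞,
      (∀ pq, Φ pq ≤ 1) → (∀ pq, Ψ pq ≤ 1) →
      Current.FourLocal (latEdgesWithin (box 4 L) u (ℓ (s - 1))) Φ →
      Current.FourLocal (latEdgesBeyond (box 4 L) u (ℓ s)) Ψ →
      finVolFourMass (box 4 L) β u y y (Φ * Ψ) * finVolFourNrm (box 4 L) β u y y ≤
        finVolFourMass (box 4 L) β u y y Φ * finVolFourMass (box 4 L) β u y y Ψ +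
          ENNReal.ofReal (Cm * Real.log ((ℓ s : ℝ) / (ℓ (s - 1))) ^ (-cm)) * finVolFourNrm (box 4 L) β u y y ^ 2 := by
    intro s hs
    obtain ⟨hs2, hs3⟩ := hEK s hs
    have hn₀ : n₀m ≤ ℓ (s - 1) := hn₀m.trans (hℓmono (by omega))
    have hp : ((ℓ (s - 1) : ℕ) : ℝ) ^ αm ≤ ℓ s := by
      have := hpowle (s - 1) (by omega) (by omega) αm hααm
      rwa [show s - 1 + 1 = s by omega] at this
    have hyN : (ℓ s : ℝ) ≤ dist u y := le_trans (by exact_mod_cast hℓmono (by omega : s ≤ K - 1)) hyfar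
    exact hMix β hβpos hβc u y (ℓ (s - 1)) (ℓ s) hn₀ hp (hwinle _ (hℓmono (by omega))) hyN
  have EvRel : ∀ xf zf : Site 4, (ℓ K : ℝ) < dist u xf → (ℓ K : ℝ) < dist u zf →
      ∀ᶠ L : ℕ in atTop, ∀ Φ : Current.FourCfg (boxGraph (box 4 L)) → ℝ≥0∞, (∀ pq, Φ pq ≤ 1) →
        Current.FourLocal (latEdgesWithin (box 4 L) u (ℓ (K - 2))) Φ →
        finVolFourMass (box 4 L) β u xf zf Φ * finVolFourNrm (box 4 L) β u y y ≤
          finVolFourMass (box 4 L) β u y y Φ * finVolFourNrm (box 4 L) β u xf zf +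
            ENNReal.ofReal εr * (finVolFourNrm (box 4 L) β u xf zf * finVolFourNrm (box 4 L) β u y y) := by
    intro xf zf hx hz
    rw [hεrdef]
    have hn₀ : n₀r ≤ ℓ (K - 2) := hn₀r.trans (hℓmono (by omega))
    have hp : ((ℓ (K - 2) : ℕ) : ℝ) ^ αr ≤ ℓ (K - 1) := by
      have := hpowle (K - 2) (by omega) (by omega) αr hααr
      rwa [show K - 2 + 1 = K - 1 by omega] at this
    have hKK : (ℓ (K - 1) : ℝ) ≤ ℓ K := by exact_mod_cast hℓmono (by omega : K - 1 ≤ K)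
    exact hRel β hβpos hβc u xf zf y (ℓ (K - 2)) (ℓ (K - 1)) hn₀ hp (hwinle _ (hℓmono (by omega)))
      (by linarith) (by linarith) hyfar
  /- ### The clustering bound for the far sources, then the four cases -/
  have key : ∀ xf yo zf tw : Site 4, (ℓ K : ℝ) < dist u xf → (ℓ K : ℝ) < dist u zf →
      ∀ᶠ L : ℕ in atTop, ∀ (hu : u ∈ box 4 L) (hxf : xf ∈ box 4 L) (hyo : yo ∈ box 4 L) (hzf : zf ∈ box 4 L)
        (htw : tw ∈ box 4 L),
        Current.clusteringMassLT (G := boxGraph (box 4 L)) (fun _ => β) ℓ K θ ⟨xf, hxf⟩ ⟨yo, hyo⟩ ⟨zf, hzf⟩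
            ⟨tw, htw⟩ ⟨u, hu⟩ ≤
          ENNReal.ofReal ((2 : ℝ) ^ (-(δ * K))) *
            (ecurrentSum (fun _ : (boxGraph (box 4 L)).edgeFinset => β) ({⟨yo, hyo⟩} ∆ {⟨u, hu⟩}) *
              ecurrentSum (fun _ : (boxGraph (box 4 L)).edgeFinset => β) ({⟨xf, hxf⟩} ∆ {⟨u, hu⟩}) *
              (ecurrentSum (fun _ : (boxGraph (box 4 L)).edgeFinset => β) ({⟨tw, htw⟩} ∆ {⟨u, hu⟩}) *
                ecurrentSum (fun _ : (boxGraph (box 4 L)).edgeFinset => β) ({⟨zf, hzf⟩} ∆ {⟨u, hu⟩}))) := by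
    intro xf yo zf tw hx hz
    have hKK : (ℓ (K - 2) : ℝ) ≤ ℓ K := by exact_mod_cast hℓmono (by omega : K - 2 ≤ K)
    have hT1 := clusteringMassLT_box_le_of_eventually hβpos ℓ hℓmono hEsub hgap hRE (hKK.trans hx.le)
      (hKK.trans hz.le) hc₀pos.le (by linarith) hc₀cI (fun s => Cm * Real.log ((ℓ s : ℝ) / (ℓ (s - 1))) ^ (-cm))
      εr EvInt EvMix hε (EvRel xf zf hx hz) θ yo tw
    filter_upwards [hT1] with L hL
    intro hu hxf hyo hzf htw
    refine (hL hu hxf hyo hzf htw).trans (mul_le_mul' ?_ le_rfl)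
    rw [hcardE]
    exact hnum'
  -- the four cases (which source of each pair is the far one)
  have hCtop : ENNReal.ofReal ((2 : ℝ) ^ (-(δ * K))) ≠ ∞ := ENNReal.ofReal_ne_top
  have hCreal : (ENNReal.ofReal ((2 : ℝ) ^ (-(δ * K)))).toReal = (2 : ℝ) ^ (-(δ * K)) :=
    ENNReal.toReal_ofReal (Real.rpow_nonneg (by norm_num) _)
  rcases h01 with h0 | h1 <;> rcases h23 with h2 | h3
  · filter_upwards [key (x 0) (x 1) (x 2) (x 3) h0 h2, hmem] with L hL hn
    have h := hL hn.1 (hn.2 0) (hn.2 1) (hn.2 2) (hn.2 3)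
    rw [← hCreal]
    refine finVolClusteringRatio_le_of_le hβ ℓ K θ hn.2 hn.1 hCtop (h.trans (le_of_eq ?_))
    ring
  · filter_upwards [key (x 0) (x 1) (x 3) (x 2) h0 h3, hmem] with L hL hn
    have h := hL hn.1 (hn.2 0) (hn.2 1) (hn.2 3) (hn.2 2)
    rw [← hCreal]
    refine finVolClusteringRatio_le_of_le hβ ℓ K θ hn.2 hn.1 hCtop ?_
    rw [Current.clusteringMassLT_swap_right]
    refine h.trans (le_of_eq ?_)
    ring
  · filter_upwards [key (x 1) (x 0) (x 2) (x 3) h1 h2, hmem] with L hL hn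
    have h := hL hn.1 (hn.2 1) (hn.2 0) (hn.2 2) (hn.2 3)
    rw [← hCreal]
    refine finVolClusteringRatio_le_of_le hβ ℓ K θ hn.2 hn.1 hCtop ?_
    rw [Current.clusteringMassLT_swap_left]
    refine h.trans (le_of_eq ?_)
    ring
  · filter_upwards [key (x 1) (x 0) (x 3) (x 2) h1 h3, hmem] with L hL hn
    have h := hL hn.1 (hn.2 1) (hn.2 0) (hn.2 3) (hn.2 2)
    rw [← hCreal]
    refine finVolClusteringRatio_le_of_le hβ ℓ K θ hn.2 hn.1 hCtop ?_
    rw [Current.clusteringMassLT_swap]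
    refine h.trans (le_of_eq ?_)
    ring

end Assembly

end Literature.Probability.LatticeModels
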